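import Summits.KontsevichZagierPeriods.KontsevichZagierPeriods.Theorems.EllipticMomentKernel.Negative.GeneralCurve
import Summits.KontsevichZagierPeriods.KontsevichZagierPeriods.Theorems.EllipticMomentKernel.Negative.DimEval
import Literature.NumberTheory.Transcendental.KZLogCalculusProofs
import Literature.NumberTheory.Transcendental.KZSemialgebraicComplex
import Mathlib.Analysis.Calculus.Deriv.Polynomial

/-!
# Drefute gen 2 — line `merge-first-single-hermite` of crux `EllipticMomentKernel`
# (stmt-KontsevichZagierPeriods-10631): the stub set is CONSISTENT AND TRUE — all six stubs are
# theorems as typed, and the skeleton's own glue then closes `EllipticMomentKernel` sorry-free.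

Refuter seat `refuter-drefute-stmt-KontsevichZagierPeriods-10631-g2-0` (mode drefute, gen 2).
This file is a CERTIFICATE for the stub attack, not a landing (the crux is the lead's to land).
It is SELF-CONTAINED over landed tree modules only (`Negative.GeneralCurve` and Literature), because
the farm serves stale/unbuilt oleans of the crux workfiles `Cruxes/EllipticMomentKernel/*.lean`:

* Part A = gen-1 drefute `Cruxes/EllipticMomentKernel/DrefuteCandidates.lean` v4 VERBATIM
  (re-homed to namespace `…EllipticMomentKernel.DrefuteG2.PartA` so that no FQN of the tree is re-declared): `stub_sigmaRep`, `stub_numeratorValue`,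
  `stub_mergeToCarrier`, `stub_polynomialPart`, `stub_hermiteExactForm` proved as typed;
* Part B = the standing disprover's `Cruxes/EllipticMomentKernel/Disproof.lean` §9 VERBATIM
  (`section VerticalDescent`, re-homed over the `EllipticMomentKernelNegative` vocabulary, to which
  the Disproof's private copies `cubic/disc/oval/underGraph` are definitionally equal): ONE
  `newtonLeibnizRel` instance with OPEN base `σ` and variable bound `√f`, ONE `domainAddRel` move
  across the two null graphs `y = 0`, `y = √f` ⇒ `verticalDescent`;
* Part C = the six `stub_*` of `Lines/merge-first-single-hermite.lean` (sha256 b28aeeea…) with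
  signatures VERBATIM, each discharged in one line from A/B (`stub_columnMove`, the lead-held
  hardest stub, = `verticalDescent` + the congruence `KZ.of_sub_of_mem_relations_of_eqOn`), followed
  by the skeleton's §0/§2 glue UNCHANGED (`hermiteDecomposition`, `gens₂_carrier`,
  `integral_hermiteOp_div_sqrt_eq_zero`, `rigid_coordinates`, `EllipticMomentKernel_of`).

Verdict of the stub attack: 0 stub-false, 0 stub-misstated, 6 survived — each stub is a theorem as
typed, so no counterexample, vacuity or mis-typing can exist; the line closes
(`DrefuteG2.EllipticMomentKernel_of : EllipticMomentKernel`, axioms propext/Classical.choice/Quot.sound).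
-/

noncomputable section

open MeasureTheory Set
open scoped Polynomial

/-! # Part A — gen-1 drefute candidates (DrefuteCandidates.lean v4, verbatim) -/

namespace Summit.KontsevichZagierPeriods.HermiteRigidity.EllipticMomentKernel.DrefuteG2.PartA

open Literature.NumberTheory.Transcendental
open Literature.NumberTheory.Transcendental.KZ
open Summit.KontsevichZagierPeriods.HermiteRigidity.EllipticMomentKernelNegative
open Literature.ModelTheory.ExponentialFields (IsSemialgebraic isSemialgebraic_univ)

variable {q₂ q₃ : ℚ}

/-- A compact box containing the oval: `σ = (e₃,e₂) ⊆ [e₃,e₂]`. [folklore] -/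
theorem exists_isCompact_superset_oval (h : 0 < disc q₂ q₃) :
    ∃ K : Set (Fin 1 → ℝ), IsCompact K ∧ oval q₂ q₃ ⊆ K := by
  obtain ⟨e₃, e₂, e₁, h3, h2a, h2b, h1, hf⟩ := exists_roots h
  have h32 : e₃ < e₂ := by linarith
  have h21 : e₂ < e₁ := by linarith
  refine ⟨Set.Icc (fun _ => e₃) (fun _ => e₂), isCompact_Icc, fun p hp => ?_⟩
  rw [oval_eq_of_roots h32 h21 hf] at hp
  refine ⟨fun i => ?_, fun i => ?_⟩
  · rw [Subsingleton.elim i 0]; exact hp.1.le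
  · rw [Subsingleton.elim i 0]; exact hp.2.le

/-- Polynomials are integrable on the (bounded) oval. [folklore] -/
theorem integrableOn_aeval_oval (h : 0 < disc q₂ q₃) (A : ℚ[X]) :
    IntegrableOn (fun p : Fin 1 → ℝ => (Polynomial.aeval (p 0) A : ℝ)) (oval q₂ q₃) := by
  obtain ⟨K, hK, hsub⟩ := exists_isCompact_superset_oval h
  have hc : Continuous fun p : Fin 1 → ℝ => (Polynomial.aeval (p 0) A : ℝ) :=
    (Polynomial.continuous_aeval A).comp (continuous_apply 0)
  exact (hc.continuousOn.integrableOn_compact hK).mono_set hsub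

/-- `E(x)/√f(x)` is integrable on the oval for every `E ∈ ℚ[X]` (bounded times `1/√f ∈ L¹(σ)`).
[folklore] -/
theorem integrableOn_aeval_div_sqrt_oval (h : 0 < disc q₂ q₃) (E : ℚ[X]) :
    IntegrableOn (fun p : Fin 1 → ℝ => (Polynomial.aeval (p 0) E : ℝ) / Real.sqrt (cubic q₂ q₃ (p 0)))
      (oval q₂ q₃) := by
  obtain ⟨K, hK, hsub⟩ := exists_isCompact_superset_oval h
  have hc : Continuous fun p : Fin 1 → ℝ => (Polynomial.aeval (p 0) E : ℝ) :=
    (Polynomial.continuous_aeval E).comp (continuous_apply 0)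
  have h0 : IntegrableOn (fun p : Fin 1 → ℝ => 1 / Real.sqrt (cubic q₂ q₃ (p 0))) (oval q₂ q₃) := by
    simpa using integrableOn_genIntegrandQ_oval h 0
  have hmeas : MeasurableSet (oval q₂ q₃) := (isSemialgebraic_oval h).measurableSet_holds
  have hmul := h0.continuousOn_mul_of_subset hc.continuousOn hK hmeas hsub
  refine hmul.congr_fun (fun p _ => ?_) hmeas
  simp only [mul_one_div]

/-- `stub_numeratorValue`, verbatim signature, sorry-free. -/
theorem stub_numeratorValue (q₂ q₃ : ℚ) (hΔ : 0 < disc q₂ q₃) (A E : ℚ[X]) (α β : ℚ)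
    (hE : (∫ p in oval q₂ q₃, (Polynomial.aeval (p 0) E : ℝ) / Real.sqrt (cubic q₂ q₃ (p 0))) = 0)
    (s : IntegralRep 1) (hs : s.domain = oval q₂ q₃)
    (hsi : EqOn s.integrand (fun p => (Polynomial.aeval (p 0) A : ℝ) +
      (Polynomial.aeval (p 0) (Polynomial.C α + Polynomial.C β * Polynomial.X + E) : ℝ) /
        Real.sqrt (cubic q₂ q₃ (p 0))) (oval q₂ q₃)) :
    s.value = (∫ p in oval q₂ q₃, (Polynomial.aeval (p 0) A : ℝ)) +
      (α : ℝ) * J0 q₂ q₃ + (β : ℝ) * J1 q₂ q₃ := by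
  have hmeas : MeasurableSet (oval q₂ q₃) := hs ▸ IntegralRep.measurableSet_domain_holds s
  have hA := integrableOn_aeval_oval hΔ A
  have h0 : IntegrableOn (fun p : Fin 1 → ℝ => 1 / Real.sqrt (cubic q₂ q₃ (p 0))) (oval q₂ q₃) := by
    simpa using integrableOn_genIntegrandQ_oval hΔ 0
  have h1 : IntegrableOn (fun p : Fin 1 → ℝ => p 0 / Real.sqrt (cubic q₂ q₃ (p 0))) (oval q₂ q₃) := by
    simpa using integrableOn_genIntegrandQ_oval hΔ 1
  have hEi := integrableOn_aeval_div_sqrt_oval hΔ E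
  have hα : IntegrableOn (fun p : Fin 1 → ℝ => (α : ℝ) * (1 / Real.sqrt (cubic q₂ q₃ (p 0))))
      (oval q₂ q₃) := Integrable.const_mul h0 _
  have hβ : IntegrableOn (fun p : Fin 1 → ℝ => (β : ℝ) * (p 0 / Real.sqrt (cubic q₂ q₃ (p 0))))
      (oval q₂ q₃) := Integrable.const_mul h1 _
  have hAα : IntegrableOn (fun p : Fin 1 → ℝ => (Polynomial.aeval (p 0) A : ℝ) +
      (α : ℝ) * (1 / Real.sqrt (cubic q₂ q₃ (p 0)))) (oval q₂ q₃) := hA.add hα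
  have hAαβ : IntegrableOn (fun p : Fin 1 → ℝ => (Polynomial.aeval (p 0) A : ℝ) +
      (α : ℝ) * (1 / Real.sqrt (cubic q₂ q₃ (p 0))) +
      (β : ℝ) * (p 0 / Real.sqrt (cubic q₂ q₃ (p 0)))) (oval q₂ q₃) := hAα.add hβ
  calc s.value = ∫ p in oval q₂ q₃, s.integrand p := by rw [IntegralRep.value, hs]
    _ = ∫ p in oval q₂ q₃, ((Polynomial.aeval (p 0) A : ℝ) +
          (α : ℝ) * (1 / Real.sqrt (cubic q₂ q₃ (p 0))) +
          (β : ℝ) * (p 0 / Real.sqrt (cubic q₂ q₃ (p 0))) +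
          (Polynomial.aeval (p 0) E : ℝ) / Real.sqrt (cubic q₂ q₃ (p 0))) := by
        refine setIntegral_congr_fun hmeas fun p hp => ?_
        rw [hsi hp]
        simp only [map_add, map_mul, Polynomial.aeval_C, Polynomial.aeval_X, eq_ratCast]
        ring
    _ = (∫ p in oval q₂ q₃, ((Polynomial.aeval (p 0) A : ℝ) +
          (α : ℝ) * (1 / Real.sqrt (cubic q₂ q₃ (p 0))) +
          (β : ℝ) * (p 0 / Real.sqrt (cubic q₂ q₃ (p 0))))) +
          (∫ p in oval q₂ q₃, (Polynomial.aeval (p 0) E : ℝ) / Real.sqrt (cubic q₂ q₃ (p 0))) :=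
        integral_add hAαβ hEi
    _ = (∫ p in oval q₂ q₃, ((Polynomial.aeval (p 0) A : ℝ) +
          (α : ℝ) * (1 / Real.sqrt (cubic q₂ q₃ (p 0))))) +
          (∫ p in oval q₂ q₃, (β : ℝ) * (p 0 / Real.sqrt (cubic q₂ q₃ (p 0)))) +
          (∫ p in oval q₂ q₃, (Polynomial.aeval (p 0) E : ℝ) / Real.sqrt (cubic q₂ q₃ (p 0))) := by
        congr 1
        exact integral_add hAα hβ
    _ = (∫ p in oval q₂ q₃, (Polynomial.aeval (p 0) A : ℝ)) +
          (∫ p in oval q₂ q₃, (α : ℝ) * (1 / Real.sqrt (cubic q₂ q₃ (p 0)))) +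
          (∫ p in oval q₂ q₃, (β : ℝ) * (p 0 / Real.sqrt (cubic q₂ q₃ (p 0)))) +
          (∫ p in oval q₂ q₃, (Polynomial.aeval (p 0) E : ℝ) / Real.sqrt (cubic q₂ q₃ (p 0))) := by
        congr 2
        exact integral_add hA hα
    _ = (∫ p in oval q₂ q₃, (Polynomial.aeval (p 0) A : ℝ)) +
          (α : ℝ) * J0 q₂ q₃ + (β : ℝ) * J1 q₂ q₃ := by
        rw [integral_const_mul, integral_const_mul, hE, add_zero]
        rfl

/-- The carrier integrand `A(x) + B(x)/√f(x)` is `ℚ`-semialgebraic on the oval. [folklore] -/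
theorem isSemialgebraicFunOn_carrier (h : 0 < disc q₂ q₃) (A B : ℚ[X]) :
    IsSemialgebraicFunOn ℚ (oval q₂ q₃) (fun p : Fin 1 → ℝ => (Polynomial.aeval (p 0) A : ℝ) +
      (Polynomial.aeval (p 0) B : ℝ) / Real.sqrt (cubic q₂ q₃ (p 0))) := by
  have hs := isSemialgebraic_oval h
  -- a one-variable polynomial read as an `MvPolynomial (Fin 1) ℚ`
  have hpoly : ∀ (P : ℚ[X]), IsSemialgebraicFunOn ℚ (oval q₂ q₃)
      (fun p : Fin 1 → ℝ => (Polynomial.aeval (p 0) P : ℝ)) := by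
    intro P
    refine (isSemialgebraicFunOn_aeval hs
      (Polynomial.aeval (MvPolynomial.X 0 : MvPolynomial (Fin 1) ℚ) P)).congr fun p _ => ?_
    dsimp only
    rw [← Polynomial.aeval_algHom_apply (MvPolynomial.aeval p) (MvPolynomial.X 0) P,
      MvPolynomial.aeval_X]
  have h0 := isSemialgebraicFunOn_genIntegrandQ h 0
  have hmul := IsSemialgebraicFunOn.mul_holds (hpoly B) h0
  have hadd := IsSemialgebraicFunOn.add_holds (hpoly A) hmul
  refine hadd.congr fun p _ => ?_
  simp only [Pi.add_apply, Pi.mul_apply, pow_zero, mul_one_div]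

/-- The carrier integrand is integrable on the oval. [folklore] -/
theorem integrableOn_carrier (h : 0 < disc q₂ q₃) (A B : ℚ[X]) :
    IntegrableOn (fun p : Fin 1 → ℝ => (Polynomial.aeval (p 0) A : ℝ) +
      (Polynomial.aeval (p 0) B : ℝ) / Real.sqrt (cubic q₂ q₃ (p 0))) (oval q₂ q₃) :=
  (integrableOn_aeval_oval h A).add (integrableOn_aeval_div_sqrt_oval h B)

/-- The carrier representation `[σ, A + B/√f]`. [cite: KontsevichZagier2001, §1.1] -/
def carrierRep (h : 0 < disc q₂ q₃) (A B : ℚ[X]) : IntegralRep 1 where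
  domain := oval q₂ q₃
  integrand := fun p => (Polynomial.aeval (p 0) A : ℝ) +
    (Polynomial.aeval (p 0) B : ℝ) / Real.sqrt (cubic q₂ q₃ (p 0))
  isSemialgebraic_domain := isSemialgebraic_oval h
  isSemialgebraicFunOn_integrand := isSemialgebraicFunOn_carrier h A B
  integrableOn := integrableOn_carrier h A B

/-- `stub_sigmaRep`, verbatim signature, sorry-free. -/
theorem stub_sigmaRep (q₂ q₃ : ℚ) (hΔ : 0 < disc q₂ q₃) (A B : ℚ[X]) :
    ∃ s : IntegralRep 1, s.domain = oval q₂ q₃ ∧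
      s.integrand = fun p => (Polynomial.aeval (p 0) A : ℝ) +
        (Polynomial.aeval (p 0) B : ℝ) / Real.sqrt (cubic q₂ q₃ (p 0)) :=
  ⟨carrierRep hΔ A B, rfl, rfl⟩

/-- `stub_mergeToCarrier`, verbatim signature, sorry-free. -/
theorem stub_mergeToCarrier (q₂ q₃ : ℚ) (_hΔ : 0 < disc q₂ q₃)
    (hrep : ∀ A B : ℚ[X], ∃ s : IntegralRep 1, s.domain = oval q₂ q₃ ∧
      s.integrand = fun p => (Polynomial.aeval (p 0) A : ℝ) +
        (Polynomial.aeval (p 0) B : ℝ) / Real.sqrt (cubic q₂ q₃ (p 0)))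
    (hgen₂ : ∀ x ∈ gens₂ q₂ q₃, ∃ (A B : ℚ[X]) (s : IntegralRep 1), s.domain = oval q₂ q₃ ∧
      EqOn s.integrand (fun p => (Polynomial.aeval (p 0) A : ℝ) +
        (Polynomial.aeval (p 0) B : ℝ) / Real.sqrt (cubic q₂ q₃ (p 0))) (oval q₂ q₃) ∧
      x - KZ.of s ∈ KZ.relations) :
    ∀ c ∈ AddSubgroup.closure (gens q₂ q₃), ∃ (A B : ℚ[X]) (s : IntegralRep 1),
      s.domain = oval q₂ q₃ ∧
      EqOn s.integrand (fun p => (Polynomial.aeval (p 0) A : ℝ) +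
        (Polynomial.aeval (p 0) B : ℝ) / Real.sqrt (cubic q₂ q₃ (p 0))) (oval q₂ q₃) ∧
      c - KZ.of s ∈ KZ.relations := by
  intro c hc
  induction hc using AddSubgroup.closure_induction with
  | mem x hx =>
    rcases hx with hx | hx
    · exact hgen₂ x hx
    · obtain ⟨r, m, hr, hri, rfl⟩ := hx
      refine ⟨0, Polynomial.X ^ m, r, hr, fun p hp => ?_, ?_⟩
      · rw [hri hp]
        simp
      · rw [sub_self]
        exact relations.zero_mem
  | zero =>
    obtain ⟨z, hz, hzi⟩ := hrep 0 0
    refine ⟨0, 0, z, hz, fun p _ => by rw [hzi], ?_⟩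
    rw [zero_sub]
    refine relations.neg_mem (of_mem_relations_of_eqOn_zero z fun p _ => ?_)
    rw [hzi]
    simp
  | add x y _ _ hx hy =>
    obtain ⟨A₁, B₁, s₁, hs₁, hs₁i, hxs⟩ := hx
    obtain ⟨A₂, B₂, s₂, hs₂, hs₂i, hys⟩ := hy
    obtain ⟨s, hs, hsi⟩ := hrep (A₁ + A₂) (B₁ + B₂)
    refine ⟨A₁ + A₂, B₁ + B₂, s, hs, fun p _ => by rw [hsi], ?_⟩
    have h1b : KZ.of s - KZ.of s₁ - KZ.of s₂ ∈ KZ.relations := by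
      refine integrandAddRel_subset_relations ⟨1, s, s₁, s₂, hs₁.trans hs.symm,
        hs₂.trans hs.symm, fun p hp => ?_, rfl⟩
      rw [hs] at hp
      rw [Pi.add_apply, hsi, hs₁i hp, hs₂i hp]
      simp only [map_add]
      ring
    have : x + y - KZ.of s = (x - KZ.of s₁) + (y - KZ.of s₂) - (KZ.of s - KZ.of s₁ - KZ.of s₂) := by
      abel
    rw [this]
    exact relations.sub_mem (relations.add_mem hxs hys) h1b
  | neg x _ hx =>
    obtain ⟨A, B, s, hs, hsi, hxs⟩ := hx
    obtain ⟨t, ht, hti⟩ := hrep (-A) (-B)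
    refine ⟨-A, -B, t, ht, fun p _ => by rw [hti], ?_⟩
    have hst : KZ.of s + KZ.of t ∈ KZ.relations := by
      refine of_add_of_mem_relations_of_eqOn_neg (ht.trans hs.symm) fun p hp => ?_
      rw [hs] at hp
      rw [hti, Pi.neg_apply, hsi hp]
      simp only [map_neg]
      ring
    have : -x - KZ.of t = -(x - KZ.of s) - (KZ.of s + KZ.of t) := by abel
    rw [this]
    exact relations.sub_mem (relations.neg_mem hxs) hst

/-! # v3: `stub_polynomialPart` -/


/-! ## Legality kit (VERBATIM copy of `Negative/Targets.lean` §7, cdisprove seat p-landed 02:37Z; copied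
only because the farm had not yet built that module when this candidate was checked — the import
version `CandidatePolyPart.lean` is identical with these declarations deleted) -/

section Kit

open Literature.ModelTheory.ExponentialFields (IsSemialgebraic isSemialgebraic_setOf_eval_pos
  isSemialgebraic_setOf_eval_eq_zero isSemialgebraic_univ)
open MvPolynomial (aeval X C)

/-- Roots of the cubic are real algebraic numbers (the cubic is a non-zero `ℚ`-polynomial).
[folklore] -/
theorem isAlgebraic_of_cubic_eq_zero {e : ℝ} (he : cubic q₂ q₃ e = 0) : IsAlgebraic ℚ e := by
  refine ⟨4 * Polynomial.X ^ 3 - Polynomial.C q₂ * Polynomial.X - Polynomial.C q₃, ?_, ?_⟩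
  · intro h0
    have h3 := congrArg (fun p : Polynomial ℚ => p.coeff 3) h0
    simp only [Polynomial.coeff_sub, Polynomial.coeff_C_mul,
      Polynomial.coeff_X, Polynomial.coeff_C, Polynomial.coeff_zero] at h3
    norm_num at h3
  · unfold cubic at he
    simp only [map_sub, map_mul, map_pow, Polynomial.aeval_X, Polynomial.aeval_C, eq_ratCast]
    have h4 : (Polynomial.aeval e) (4 : Polynomial ℚ) = (4 : ℝ) := map_ofNat _ 4
    rw [h4]
    linarith

/-- Polynomial expressions in an algebraic number are algebraic. [folklore] -/
theorem isAlgebraic_aeval_of_isAlgebraic {e : ℝ} (he : IsAlgebraic ℚ e) (R : Polynomial ℚ) :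
    IsAlgebraic ℚ (Polynomial.aeval e R) := by
  rw [isAlgebraic_iff_isIntegral] at he ⊢
  induction R using Polynomial.induction_on' with
  | add p q hp hq => simpa [map_add] using hp.add hq
  | monomial n a =>
    rw [← Polynomial.C_mul_X_pow_eq_monomial, map_mul, map_pow, Polynomial.aeval_C,
      Polynomial.aeval_X]
    exact isIntegral_algebraMap.mul (he.pow n)

/-- The constant produced by the `b`-odd branch / `stub_polynomialToConstant`,
`R(e₂) − R(e₃)` with `R ∈ ℚ[X]`, is real algebraic (so `[pt, R(e₂) − R(e₃)]` is a legal
`IntegralRep 0` by `isSemialgebraicFunOn_const_of_isAlgebraic`). [folklore] -/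
theorem isAlgebraic_aeval_sub_aeval {e₃ e₂ : ℝ} (h₃ : cubic q₂ q₃ e₃ = 0) (h₂ : cubic q₂ q₃ e₂ = 0)
    (R : Polynomial ℚ) : IsAlgebraic ℚ (Polynomial.aeval e₂ R - Polynomial.aeval e₃ R) := by
  have h := (isAlgebraic_aeval_of_isAlgebraic (isAlgebraic_of_cubic_eq_zero h₂) R)
  have h' := (isAlgebraic_aeval_of_isAlgebraic (isAlgebraic_of_cubic_eq_zero h₃) R)
  rw [isAlgebraic_iff_isIntegral] at h h' ⊢
  exact h.sub h'

/-- The three roots are the only zeros of the factored cubic. [folklore] -/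
theorem eq_roots_of_cubic_eq_zero {e₃ e₂ e₁ y : ℝ}
    (hf : ∀ x, cubic q₂ q₃ x = 4 * (x - e₃) * (x - e₂) * (x - e₁)) (hy : cubic q₂ q₃ y = 0) :
    y = e₃ ∨ y = e₂ ∨ y = e₁ := by
  rw [hf] at hy
  rcases mul_eq_zero.1 hy with h | h
  · rcases mul_eq_zero.1 h with h | h
    · rcases mul_eq_zero.1 h with h | h
      · norm_num at h
      · exact Or.inl (by linarith)
    · exact Or.inr (Or.inl (by linarith))
  · exact Or.inr (Or.inr (by linarith))

/-- The roots of the factored cubic are roots. [folklore] -/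
theorem cubic_roots_eq_zero {e₃ e₂ e₁ : ℝ}
    (hf : ∀ x, cubic q₂ q₃ x = 4 * (x - e₃) * (x - e₂) * (x - e₁)) :
    cubic q₂ q₃ e₃ = 0 ∧ cubic q₂ q₃ e₂ = 0 ∧ cubic q₂ q₃ e₁ = 0 := by
  refine ⟨?_, ?_, ?_⟩ <;> rw [hf] <;> ring

/-- The two branch points `{e₃, e₂} ⊆ ℝ¹` bounding the oval. [folklore] -/
def endsQ (e₃ e₂ : ℝ) : Set (Fin 1 → ℝ) := {z | z 0 = e₃ ∨ z 0 = e₂}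

/-- The CLOSED band `[e₃, e₂] ⊆ ℝ¹` in the literal shape of `KZ.newtonLeibnizRel` over the base
`univ ⊆ ℝ⁰` with the constant (real algebraic, in general irrational) bounds `a = e₃`, `b = e₂` —
the band of the Hermite move (`stub_hermiteReduction`) and of `stub_polynomialToConstant`.
[folklore] -/
def closedBandQ (e₃ e₂ : ℝ) : Set (Fin 1 → ℝ) :=
  {z | (Fin.init z : Fin 0 → ℝ) ∈ (univ : Set (Fin 0 → ℝ)) ∧
    (fun _ => e₃) (Fin.init z) ≤ z (Fin.last 0) ∧ z (Fin.last 0) ≤ (fun _ => e₂) (Fin.init z)}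

/-- `closedBandQ e₃ e₂ = [e₃, e₂]`. [folklore] -/
theorem closedBandQ_eq (e₃ e₂ : ℝ) : closedBandQ e₃ e₂ = {z : Fin 1 → ℝ | e₃ ≤ z 0 ∧ z 0 ≤ e₂} := by
  ext z; simp [closedBandQ]

/-- `[e₃, e₂] = σ ∪ {e₃, e₂}` for the factored cubic. [folklore] -/
theorem closedBandQ_eq_union {e₃ e₂ e₁ : ℝ} (h32 : e₃ < e₂) (h21 : e₂ < e₁)
    (hf : ∀ x, cubic q₂ q₃ x = 4 * (x - e₃) * (x - e₂) * (x - e₁)) :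
    closedBandQ e₃ e₂ = oval q₂ q₃ ∪ endsQ e₃ e₂ := by
  rw [closedBandQ_eq, oval_eq_of_roots h32 h21 hf]
  ext z
  simp only [mem_setOf_eq, mem_union, endsQ, mem_Ioo]
  constructor
  · rintro ⟨h1, h2⟩
    rcases h1.lt_or_eq with h1 | h1
    · rcases h2.lt_or_eq with h2 | h2
      · exact Or.inl ⟨h1, h2⟩
      · exact Or.inr (Or.inr h2)
    · exact Or.inr (Or.inl h1.symm)
  · rintro (⟨h1, h2⟩ | h | h)
    · exact ⟨h1.le, h2.le⟩
    · rw [h]; exact ⟨le_rfl, h32.le⟩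
    · rw [h]; exact ⟨h32.le, le_rfl⟩

/-- `σ` and the branch points are disjoint. [folklore] -/
theorem oval_inter_endsQ {e₃ e₂ e₁ : ℝ} (h32 : e₃ < e₂) (h21 : e₂ < e₁)
    (hf : ∀ x, cubic q₂ q₃ x = 4 * (x - e₃) * (x - e₂) * (x - e₁)) :
    oval q₂ q₃ ∩ endsQ e₃ e₂ = ∅ := by
  rw [oval_eq_of_roots h32 h21 hf]
  ext z
  simp only [mem_inter_iff, mem_setOf_eq, mem_Ioo, endsQ, mem_empty_iff_false, iff_false]
  rintro ⟨⟨h1, h2⟩, h | h⟩ <;> rw [h] at h1 h2 <;> linarith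

/-- **The branch points are `ℚ`-semialgebraic for EVERY admissible parameter** — no
Tarski–Seidenberg and no explicit isolating formula needed: `e₃, e₂` are real algebraic
(`isAlgebraic_of_cubic_eq_zero`) and coordinate hyperplanes at real algebraic heights are
`ℚ`-definable (tree: `isSemialgebraic_setOf_apply_eq_of_isAlgebraic`). [folklore] -/
theorem isSemialgebraic_endsQ {e₃ e₂ : ℝ} (h₃ : cubic q₂ q₃ e₃ = 0) (h₂ : cubic q₂ q₃ e₂ = 0) :
    IsSemialgebraic ℚ (endsQ e₃ e₂) :=
  (isSemialgebraic_setOf_apply_eq_of_isAlgebraic (isAlgebraic_of_cubic_eq_zero h₃) (0 : Fin 1)).union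
    (isSemialgebraic_setOf_apply_eq_of_isAlgebraic (isAlgebraic_of_cubic_eq_zero h₂) (0 : Fin 1))

/-- The branch points form a two-point, hence Lebesgue-null, subset of `ℝ¹`. [folklore] -/
theorem volume_endsQ (e₃ e₂ : ℝ) : volume (endsQ e₃ e₂) = 0 := by
  have : endsQ e₃ e₂ = {fun _ => e₃, fun _ => e₂} := by
    ext z; simp [endsQ, funext_iff, Fin.forall_fin_one]
  rw [this]
  exact (Set.toFinite _).measure_zero _

/-- **The closed Hermite band `[e₃, e₂]` is `ℚ`-semialgebraic for every admissible parameter.**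
[folklore] -/
theorem isSemialgebraic_closedBandQ {e₃ e₂ e₁ : ℝ} (h32 : e₃ < e₂) (h21 : e₂ < e₁)
    (hf : ∀ x, cubic q₂ q₃ x = 4 * (x - e₃) * (x - e₂) * (x - e₁)) :
    IsSemialgebraic ℚ (closedBandQ e₃ e₂) := by
  obtain ⟨h₃, h₂, -⟩ := cubic_roots_eq_zero hf
  obtain ⟨hpos, -⟩ := cubic_sign_of_roots h32 h21 hf
  have hd : 0 < disc q₂ q₃ :=
    disc_pos_of_sign_change (x := (e₃ + e₂) / 2) (t := (e₂ + e₁) / 2) (by linarith)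
      (hpos _ ⟨by linarith, by linarith⟩)
      ((cubic_sign_of_roots h32 h21 hf).2 _ ⟨by linarith, by linarith⟩)
  rw [closedBandQ_eq_union h32 h21 hf]
  exact (isSemialgebraic_oval hd).union (isSemialgebraic_endsQ h₃ h₂)

/-- The bounds of the Hermite band are legal: the constant functions `e₃`, `e₂` on the base
`univ ⊆ ℝ⁰` are `ℚ`-semialgebraic (tree: `isSemialgebraicFunOn_const_of_isAlgebraic`). [folklore] -/
theorem isSemialgebraicFunOn_const_root {e : ℝ} (he : cubic q₂ q₃ e = 0) :
    IsSemialgebraicFunOn ℚ (univ : Set (Fin 0 → ℝ)) (fun _ => e) :=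
  isSemialgebraicFunOn_const_of_isAlgebraic isSemialgebraic_univ (isAlgebraic_of_cubic_eq_zero he)

end Kit


/-! ## A formal antiderivative on `ℚ[X]` -/

/-- `antideriv A = Σ aₙ X^{n+1}/(n+1)`. [folklore] -/
def antideriv (A : ℚ[X]) : ℚ[X] :=
  A.sum fun n a => Polynomial.C (a / ((n : ℚ) + 1)) * Polynomial.X ^ (n + 1)

/-- `(antideriv A)′ = A`. [folklore] -/
theorem derivative_antideriv (A : ℚ[X]) : Polynomial.derivative (antideriv A) = A := by
  conv_rhs => rw [A.as_sum_support_C_mul_X_pow]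
  rw [antideriv, Polynomial.sum_def, map_sum]
  refine Finset.sum_congr rfl fun n _ => ?_
  rw [Polynomial.derivative_C_mul_X_pow]
  have hn : ((n : ℚ) + 1) ≠ 0 := by positivity
  congr 2
  push_cast
  field_simp

/-- `x ↦ G(x)` has derivative `A(x)` (real points). [folklore] -/
theorem hasDerivAt_aeval_antideriv (A : ℚ[X]) (x : ℝ) :
    HasDerivAt (fun t : ℝ => (Polynomial.aeval t (antideriv A) : ℝ)) (Polynomial.aeval x A) x := by
  simpa [derivative_antideriv] using (antideriv A).hasDerivAt_aeval x

/-! ## Part 1: `∫_σ A = G(e₂) − G(e₃)` is real algebraic -/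

/-- FTC on the oval: `∫_σ A = G(e₂) − G(e₃)`. [folklore] -/
theorem integral_aeval_oval {e₃ e₂ e₁ : ℝ} (h32 : e₃ < e₂) (h21 : e₂ < e₁)
    (hf : ∀ x, cubic q₂ q₃ x = 4 * (x - e₃) * (x - e₂) * (x - e₁)) (A : ℚ[X]) :
    (∫ p in oval q₂ q₃, (Polynomial.aeval (p 0) A : ℝ)) =
      Polynomial.aeval e₂ (antideriv A) - Polynomial.aeval e₃ (antideriv A) := by
  have hset : oval q₂ q₃ = e1 ⁻¹' Ioo e₃ e₂ := by
    rw [oval_eq_of_roots h32 h21 hf]; ext p; simp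
  have key := measurePreserving_e1.setIntegral_preimage_emb e1.measurableEmbedding
    (fun x : ℝ => (Polynomial.aeval x A : ℝ)) (Ioo e₃ e₂)
  simp only [e1_apply] at key
  rw [hset, key, ← integral_Ioc_eq_integral_Ioo, ← intervalIntegral.integral_of_le h32.le]
  exact intervalIntegral.integral_eq_sub_of_hasDerivAt
    (fun x _ => hasDerivAt_aeval_antideriv A x)
    ((Polynomial.continuous_aeval A).intervalIntegrable _ _)

/-- **Part 1 of the stub**: `∫_σ A` is a real algebraic number. [folklore] -/
theorem isAlgebraic_integral_aeval_oval (h : 0 < disc q₂ q₃) (A : ℚ[X]) :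
    IsAlgebraic ℚ (∫ p in oval q₂ q₃, (Polynomial.aeval (p 0) A : ℝ)) := by
  obtain ⟨e₃, e₂, e₁, h3, h2a, h2b, h1, hf⟩ := exists_roots h
  have h32 : e₃ < e₂ := by linarith
  have h21 : e₂ < e₁ := by linarith
  obtain ⟨he₃, he₂, -⟩ := cubic_roots_eq_zero hf
  rw [integral_aeval_oval h32 h21 hf A]
  exact isAlgebraic_aeval_sub_aeval he₃ he₂ (antideriv A)

/-! ## Part 2: `[σ, A] ∈ relations` when `∫_σ A = 0` — one Newton–Leibniz move over `ℝ⁰` -/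

section PartTwo

variable {e₃ e₂ e₁ : ℝ}

/-- A one-variable `ℚ`-polynomial is a `ℚ`-semialgebraic function on any `ℚ`-semialgebraic
`s ⊆ ℝ¹`. [folklore] -/
theorem isSemialgebraicFunOn_aeval_apply_zero {s : Set (Fin 1 → ℝ)} (hs : IsSemialgebraic ℚ s)
    (P : ℚ[X]) : IsSemialgebraicFunOn ℚ s (fun p : Fin 1 → ℝ => (Polynomial.aeval (p 0) P : ℝ)) := by
  refine (isSemialgebraicFunOn_aeval hs
    (Polynomial.aeval (MvPolynomial.X 0 : MvPolynomial (Fin 1) ℚ) P)).congr fun p _ => ?_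
  dsimp only
  rw [← Polynomial.aeval_algHom_apply (MvPolynomial.aeval p) (MvPolynomial.X 0) P,
    MvPolynomial.aeval_X]

/-- The closed band is compact (`= e1 ⁻¹' [e₃, e₂]`, a box). [folklore] -/
theorem closedBandQ_subset_Icc (e₃ e₂ : ℝ) :
    closedBandQ e₃ e₂ ⊆ Set.Icc (fun _ : Fin 1 => e₃) (fun _ => e₂) := by
  intro z hz
  rw [closedBandQ_eq] at hz
  refine ⟨fun i => ?_, fun i => ?_⟩
  · rw [Subsingleton.elim i 0]; exact hz.1
  · rw [Subsingleton.elim i 0]; exact hz.2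

/-- The band representation `[[e₃,e₂], A]` (the `r` of the Newton–Leibniz move). [folklore] -/
def polyBandRep (h32 : e₃ < e₂) (h21 : e₂ < e₁)
    (hf : ∀ x, cubic q₂ q₃ x = 4 * (x - e₃) * (x - e₂) * (x - e₁)) (A : ℚ[X]) : IntegralRep 1 where
  domain := closedBandQ e₃ e₂
  integrand := fun p => (Polynomial.aeval (p 0) A : ℝ)
  isSemialgebraic_domain := isSemialgebraic_closedBandQ h32 h21 hf
  isSemialgebraicFunOn_integrand :=
    isSemialgebraicFunOn_aeval_apply_zero (isSemialgebraic_closedBandQ h32 h21 hf) A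
  integrableOn :=
    ((((Polynomial.continuous_aeval A).comp (continuous_apply 0)).continuousOn.integrableOn_compact
      isCompact_Icc).mono_set (closedBandQ_subset_Icc e₃ e₂))

/-- The null representation on the two ends `{e₃, e₂}` with integrand `A`. [folklore] -/
def polyEndsRep (hf : ∀ x, cubic q₂ q₃ x = 4 * (x - e₃) * (x - e₂) * (x - e₁)) (A : ℚ[X]) :
    IntegralRep 1 where
  domain := endsQ e₃ e₂
  integrand := fun p => (Polynomial.aeval (p 0) A : ℝ)
  isSemialgebraic_domain :=
    isSemialgebraic_endsQ (cubic_roots_eq_zero hf).1 (cubic_roots_eq_zero hf).2.1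
  isSemialgebraicFunOn_integrand :=
    isSemialgebraicFunOn_aeval_apply_zero
      (isSemialgebraic_endsQ (cubic_roots_eq_zero hf).1 (cubic_roots_eq_zero hf).2.1) A
  integrableOn := by
    rw [IntegrableOn, Measure.restrict_eq_zero.2 (volume_endsQ e₃ e₂)]
    exact integrable_zero_measure

/-- The base of the move: the point `ℝ⁰` with integrand `0`. [folklore] -/
def zeroBaseRep : IntegralRep 0 where
  domain := univ
  integrand := fun _ => 0
  isSemialgebraic_domain := isSemialgebraic_univ
  isSemialgebraicFunOn_integrand :=
    (isSemialgebraicFunOn_aeval isSemialgebraic_univ (0 : MvPolynomial (Fin 0) ℚ)).congr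
      fun _ _ => by simp
  integrableOn := integrableOn_zero

/-- `[pt, 0] ∈ relations`. [folklore] -/
theorem of_zeroBaseRep_mem_relations : KZ.of zeroBaseRep ∈ relations :=
  of_mem_relations_of_eqOn_zero zeroBaseRep fun _ _ => rfl

/-- `Fin.snoc` into `ℝ¹` from `ℝ⁰`. [folklore] -/
theorem snoc_apply_zero' (x : Fin 0 → ℝ) (t : ℝ) : (Fin.snoc x t : Fin 1 → ℝ) 0 = t := rfl

/-- **The polynomial part is ONE legal Newton–Leibniz move** when `G(e₂) − G(e₃) = 0`:
`[polyBandRep] − [zeroBaseRep] ∈ KZ.newtonLeibnizRel` (base `ℝ⁰`, bounds `a = e₃`, `b = e₂`,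
primitive `G`). [cite: KontsevichZagier2001, §1.2 rule (3)] -/
theorem of_polyBandRep_sub_mem_newtonLeibnizRel (h32 : e₃ < e₂) (h21 : e₂ < e₁)
    (hf : ∀ x, cubic q₂ q₃ x = 4 * (x - e₃) * (x - e₂) * (x - e₁)) (A : ℚ[X])
    (hG : (Polynomial.aeval e₂ (antideriv A) : ℝ) - Polynomial.aeval e₃ (antideriv A) = 0) :
    KZ.of (polyBandRep h32 h21 hf A) - KZ.of zeroBaseRep ∈ newtonLeibnizRel := by
  obtain ⟨he₃, he₂, -⟩ := cubic_roots_eq_zero hf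
  refine ⟨0, polyBandRep h32 h21 hf A, zeroBaseRep, fun _ => e₃, fun _ => e₂,
    fun z => (Polynomial.aeval (z 0) (antideriv A) : ℝ), ?_, ?_, ?_, fun _ _ => h32.le, rfl,
    ?_, ?_, ?_, rfl⟩
  · exact isSemialgebraicFunOn_aeval_apply_zero (isSemialgebraic_closedBandQ h32 h21 hf) _
  · exact isSemialgebraicFunOn_const_root he₃
  · exact isSemialgebraicFunOn_const_root he₂
  · intro x _
    show ContinuousOn (fun t : ℝ =>
      (Polynomial.aeval ((Fin.snoc x t : Fin 1 → ℝ) 0) (antideriv A) : ℝ)) _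
    simp only [snoc_apply_zero']
    exact (Polynomial.continuous_aeval _).continuousOn
  · intro x _ t _
    show HasDerivAt (fun s : ℝ =>
      (Polynomial.aeval ((Fin.snoc x s : Fin 1 → ℝ) 0) (antideriv A) : ℝ))
      ((polyBandRep h32 h21 hf A).integrand (Fin.snoc x t)) t
    simp only [snoc_apply_zero', polyBandRep]
    exact hasDerivAt_aeval_antideriv A t
  · intro x _
    show (0 : ℝ) = (Polynomial.aeval ((Fin.snoc x ((fun _ => e₂) x) : Fin 1 → ℝ) 0) (antideriv A) : ℝ)
      - Polynomial.aeval ((Fin.snoc x ((fun _ => e₃) x) : Fin 1 → ℝ) 0) (antideriv A)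
    simp only [snoc_apply_zero']
    exact hG.symm

/-- `[polyBandRep] ∈ relations` when `G(e₂) − G(e₃) = 0`. [folklore] -/
theorem of_polyBandRep_mem_relations (h32 : e₃ < e₂) (h21 : e₂ < e₁)
    (hf : ∀ x, cubic q₂ q₃ x = 4 * (x - e₃) * (x - e₂) * (x - e₁)) (A : ℚ[X])
    (hG : (Polynomial.aeval e₂ (antideriv A) : ℝ) - Polynomial.aeval e₃ (antideriv A) = 0) :
    KZ.of (polyBandRep h32 h21 hf A) ∈ relations := by
  have h1 := newtonLeibnizRel_subset_relations
    (of_polyBandRep_sub_mem_newtonLeibnizRel h32 h21 hf A hG)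
  simpa using relations.add_mem h1 of_zeroBaseRep_mem_relations

/-- `[polyEndsRep] ∈ relations` (null domain). [folklore] -/
theorem of_polyEndsRep_mem_relations
    (hf : ∀ x, cubic q₂ q₃ x = 4 * (x - e₃) * (x - e₂) * (x - e₁)) (A : ℚ[X]) :
    KZ.of (polyEndsRep hf A) ∈ relations :=
  of_mem_relations_of_volume_eq_zero _ (volume_endsQ e₃ e₂)

/-- **Part 2 of the stub**: closed band versus open `σ` is ONE domain-additivity move, so every
representation `[σ, A]` with `G(e₂) − G(e₃) = 0` is a relation. [folklore] -/
theorem of_mem_relations_of_poly (h32 : e₃ < e₂) (h21 : e₂ < e₁)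
    (hf : ∀ x, cubic q₂ q₃ x = 4 * (x - e₃) * (x - e₂) * (x - e₁)) (A : ℚ[X])
    (hG : (Polynomial.aeval e₂ (antideriv A) : ℝ) - Polynomial.aeval e₃ (antideriv A) = 0)
    (s : IntegralRep 1) (hs : s.domain = oval q₂ q₃)
    (hsi : EqOn s.integrand (fun p => (Polynomial.aeval (p 0) A : ℝ)) (oval q₂ q₃)) :
    KZ.of s ∈ KZ.relations := by
  have hadd : KZ.of (polyBandRep h32 h21 hf A) - KZ.of s - KZ.of (polyEndsRep hf A) ∈ domainAddRel := by
    refine ⟨1, polyBandRep h32 h21 hf A, s, polyEndsRep hf A, ?_, ?_, fun p hp => ?_,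
      fun _ _ => rfl, rfl⟩
    · show closedBandQ e₃ e₂ = s.domain ∪ endsQ e₃ e₂
      rw [hs]; exact closedBandQ_eq_union h32 h21 hf
    · show volume (s.domain ∩ endsQ e₃ e₂) = 0
      rw [hs, oval_inter_endsQ h32 h21 hf]; exact measure_empty
    · rw [hs] at hp
      exact (hsi hp).symm
  have h2 : KZ.of s = KZ.of (polyBandRep h32 h21 hf A) -
      (KZ.of (polyBandRep h32 h21 hf A) - KZ.of s - KZ.of (polyEndsRep hf A)) -
      KZ.of (polyEndsRep hf A) := by abel
  rw [h2]
  exact relations.sub_mem (relations.sub_mem (of_polyBandRep_mem_relations h32 h21 hf A hG)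
    (domainAddRel_subset_relations hadd)) (of_polyEndsRep_mem_relations hf A)

end PartTwo

/-- `stub_polynomialPart`, verbatim signature, sorry-free. -/
theorem stub_polynomialPart (q₂ q₃ : ℚ) (hΔ : 0 < disc q₂ q₃) (A : ℚ[X]) :
    IsAlgebraic ℚ (∫ p in oval q₂ q₃, (Polynomial.aeval (p 0) A : ℝ)) ∧
    ((∫ p in oval q₂ q₃, (Polynomial.aeval (p 0) A : ℝ)) = 0 →
      ∀ s : IntegralRep 1, s.domain = oval q₂ q₃ →
        EqOn s.integrand (fun p => (Polynomial.aeval (p 0) A : ℝ)) (oval q₂ q₃) →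
        KZ.of s ∈ KZ.relations) := by
  refine ⟨isAlgebraic_integral_aeval_oval hΔ A, fun h0 s hs hsi => ?_⟩
  obtain ⟨e₃, e₂, e₁, h3, h2a, h2b, h1, hf⟩ := exists_roots hΔ
  have h32 : e₃ < e₂ := by linarith
  have h21 : e₂ < e₁ := by linarith
  rw [integral_aeval_oval h32 h21 hf A] at h0
  exact of_mem_relations_of_poly h32 h21 hf A h0 s hs hsi

/-! # v4: `stub_hermiteExactForm` = support item `HermiteExactFormVanishes` (stmt-KontsevichZagierPeriods-3412) -/

section Hermite

open Summit.KontsevichZagierPeriods.KontsevichZagierPeriods.Theses.HermiteRigidity (HermiteExactFormVanishes)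

variable {e₃ e₂ e₁ : ℝ}

/-- The Hermite integrand `(P′f + P f′/2)/√f` as a function on `ℝ¹` (junk value `0` where `f ≤ 0`).
[folklore] -/
def hermiteIntegrand (q₂ q₃ : ℚ) (P : ℚ[X]) (p : Fin 1 → ℝ) : ℝ :=
  ((Polynomial.aeval (p 0) (Polynomial.derivative P) : ℝ) * cubic q₂ q₃ (p 0) +
    (Polynomial.aeval (p 0) P : ℝ) * (12 * (p 0) ^ 2 - (q₂ : ℝ)) / 2) / Real.sqrt (cubic q₂ q₃ (p 0))

/-- Its numerator as a `ℚ`-polynomial: `N = P′·f + P·(6X² − q₂/2)`. [folklore] -/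
def hermiteNumerator (q₂ q₃ : ℚ) (P : ℚ[X]) : ℚ[X] :=
  Polynomial.derivative P * (4 * Polynomial.X ^ 3 - Polynomial.C q₂ * Polynomial.X - Polynomial.C q₃) +
    P * (Polynomial.C (1 / 2 : ℚ) * (12 * Polynomial.X ^ 2 - Polynomial.C q₂))

/-- `hermiteIntegrand = N/√f` pointwise. [folklore] -/
theorem hermiteIntegrand_eq (q₂ q₃ : ℚ) (P : ℚ[X]) (p : Fin 1 → ℝ) :
    hermiteIntegrand q₂ q₃ P p =
      (Polynomial.aeval (p 0) (hermiteNumerator q₂ q₃ P) : ℝ) / Real.sqrt (cubic q₂ q₃ (p 0)) := by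
  simp only [hermiteIntegrand, hermiteNumerator, map_add, map_mul, map_sub, map_pow,
    Polynomial.aeval_X, Polynomial.aeval_C, eq_ratCast, map_ofNat, cubic]
  push_cast
  ring

/-- At a root of `f` the Hermite integrand takes the junk value `0`. [folklore] -/
theorem hermiteIntegrand_eq_zero_of_root (P : ℚ[X]) {p : Fin 1 → ℝ} (hp : cubic q₂ q₃ (p 0) = 0) :
    hermiteIntegrand q₂ q₃ P p = 0 := by
  simp [hermiteIntegrand, hp]

/-- The Hermite integrand is `ℚ`-semialgebraic on the open oval. [folklore] -/
theorem isSemialgebraicFunOn_hermiteIntegrand_oval (h : 0 < disc q₂ q₃) (P : ℚ[X]) :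
    IsSemialgebraicFunOn ℚ (oval q₂ q₃) (hermiteIntegrand q₂ q₃ P) :=
  (isSemialgebraicFunOn_carrier h 0 (hermiteNumerator q₂ q₃ P)).congr fun p _ => by
    rw [hermiteIntegrand_eq]; simp

/-- Integrability of the Hermite integrand on the oval. [folklore] -/
theorem integrableOn_hermiteIntegrand_oval (h : 0 < disc q₂ q₃) (P : ℚ[X]) :
    IntegrableOn (hermiteIntegrand q₂ q₃ P) (oval q₂ q₃) :=
  (integrableOn_aeval_div_sqrt_oval h (hermiteNumerator q₂ q₃ P)).congr_fun
    (fun p _ => (hermiteIntegrand_eq q₂ q₃ P p).symm) (isSemialgebraic_oval h).measurableSet_holds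

/-- The Hermite integrand vanishes on the ends, hence is semialgebraic there. [folklore] -/
theorem isSemialgebraicFunOn_hermiteIntegrand_ends
    (hf : ∀ x, cubic q₂ q₃ x = 4 * (x - e₃) * (x - e₂) * (x - e₁)) (P : ℚ[X]) :
    IsSemialgebraicFunOn ℚ (endsQ e₃ e₂) (hermiteIntegrand q₂ q₃ P) := by
  obtain ⟨he₃, he₂, -⟩ := cubic_roots_eq_zero hf
  refine (isSemialgebraicFunOn_aeval (isSemialgebraic_endsQ he₃ he₂)
    (0 : MvPolynomial (Fin 1) ℚ)).congr fun p hp => ?_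
  have : cubic q₂ q₃ (p 0) = 0 := by
    rcases hp with hp | hp <;> rw [hp] <;> assumption
  simp [hermiteIntegrand_eq_zero_of_root P this]

/-- The band representation `[[e₃,e₂], (P′f + Pf′/2)/√f]` — the `r` of the Hermite move. [folklore] -/
def hermiteBandRep (h32 : e₃ < e₂) (h21 : e₂ < e₁)
    (hf : ∀ x, cubic q₂ q₃ x = 4 * (x - e₃) * (x - e₂) * (x - e₁)) (P : ℚ[X]) : IntegralRep 1 where
  domain := closedBandQ e₃ e₂
  integrand := hermiteIntegrand q₂ q₃ P
  isSemialgebraic_domain := isSemialgebraic_closedBandQ h32 h21 hf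
  isSemialgebraicFunOn_integrand := by
    have hd : 0 < disc q₂ q₃ := disc_pos_of_oval_nonempty (by
      rw [oval_eq_of_roots h32 h21 hf]
      exact ⟨fun _ => (e₃ + e₂) / 2, by simp only [mem_setOf_eq, mem_Ioo]; constructor <;> linarith⟩)
    rw [closedBandQ_eq_union h32 h21 hf]
    exact IsSemialgebraicFunOn.union (isSemialgebraicFunOn_hermiteIntegrand_oval hd P)
      (isSemialgebraicFunOn_hermiteIntegrand_ends hf P) (fun _ _ => rfl) (fun _ _ => rfl)
  integrableOn := by
    have hd : 0 < disc q₂ q₃ := disc_pos_of_oval_nonempty (by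
      rw [oval_eq_of_roots h32 h21 hf]
      exact ⟨fun _ => (e₃ + e₂) / 2, by simp only [mem_setOf_eq, mem_Ioo]; constructor <;> linarith⟩)
    rw [closedBandQ_eq_union h32 h21 hf]
    refine (integrableOn_hermiteIntegrand_oval hd P).union ?_
    rw [IntegrableOn, Measure.restrict_eq_zero.2 (volume_endsQ e₃ e₂)]
    exact integrable_zero_measure

/-- The null representation on the ends with the Hermite integrand. [folklore] -/
def hermiteEndsRep (hf : ∀ x, cubic q₂ q₃ x = 4 * (x - e₃) * (x - e₂) * (x - e₁)) (P : ℚ[X]) :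
    IntegralRep 1 where
  domain := endsQ e₃ e₂
  integrand := hermiteIntegrand q₂ q₃ P
  isSemialgebraic_domain :=
    isSemialgebraic_endsQ (cubic_roots_eq_zero hf).1 (cubic_roots_eq_zero hf).2.1
  isSemialgebraicFunOn_integrand := isSemialgebraicFunOn_hermiteIntegrand_ends hf P
  integrableOn := by
    rw [IntegrableOn, Measure.restrict_eq_zero.2 (volume_endsQ e₃ e₂)]
    exact integrable_zero_measure

/-- The cubic has derivative `12x² − q₂`. [folklore] -/
theorem hasDerivAt_cubic_gen (q₂ q₃ : ℚ) (x : ℝ) :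
    HasDerivAt (cubic q₂ q₃) (12 * x ^ 2 - (q₂ : ℝ)) x := by
  have h3 : HasDerivAt (fun y : ℝ => y ^ 3) (3 * x ^ 2) x := by simpa using hasDerivAt_pow 3 x
  have h := ((h3.const_mul (4 : ℝ)).sub ((hasDerivAt_id x).const_mul (q₂ : ℝ))).sub_const (q₃ : ℝ)
  have hfun : cubic q₂ q₃ = fun y : ℝ => 4 * y ^ 3 - (q₂ : ℝ) * id y - (q₃ : ℝ) := by
    funext y; simp [cubic]
  have hval : (12 * x ^ 2 - (q₂ : ℝ)) = 4 * (3 * x ^ 2) - (q₂ : ℝ) * 1 := by ring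
  rw [hfun, hval]
  exact h

/-- The scalar identity behind `d(P√f) = (P′f + Pf′/2) dx/√f`. [folklore] -/
theorem hermite_alg {a b c f' s : ℝ} (hs : 0 < s) (hsq : s * s = c) :
    a * s + b * (f' / (2 * s)) = (a * c + b * f' / 2) / s := by
  rw [eq_div_iff hs.ne', ← hsq]
  field_simp

/-- `d/dt (P(t)√f(t)) = (P′f + Pf′/2)/√f` where `f t > 0`. [folklore] -/
theorem hasDerivAt_aeval_mul_sqrt (P : ℚ[X]) {t : ℝ} (ht : 0 < cubic q₂ q₃ t) :
    HasDerivAt (fun s : ℝ => (Polynomial.aeval s P : ℝ) * Real.sqrt (cubic q₂ q₃ s))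
      (hermiteIntegrand q₂ q₃ P (fun _ => t)) t := by
  have hP := P.hasDerivAt_aeval t
  have hs := (hasDerivAt_cubic_gen q₂ q₃ t).sqrt ht.ne'
  have hst : 0 < Real.sqrt (cubic q₂ q₃ t) := Real.sqrt_pos.2 ht
  have h2 : Real.sqrt (cubic q₂ q₃ t) * Real.sqrt (cubic q₂ q₃ t) = cubic q₂ q₃ t :=
    Real.mul_self_sqrt ht.le
  have key : (Polynomial.aeval t (Polynomial.derivative P) : ℝ) * Real.sqrt (cubic q₂ q₃ t) +
      (Polynomial.aeval t P : ℝ) * ((12 * t ^ 2 - (q₂ : ℝ)) / (2 * Real.sqrt (cubic q₂ q₃ t))) =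
      hermiteIntegrand q₂ q₃ P (fun _ => t) := by
    unfold hermiteIntegrand
    exact hermite_alg hst h2
  exact (hP.mul hs).congr_deriv key

/-- **The Hermite step is ONE legal Newton–Leibniz move**: `[hermiteBandRep] − [pt, 0] ∈
KZ.newtonLeibnizRel` (base `ℝ⁰`, bounds `a = e₃`, `b = e₂`, primitive `F = P√f`, continuous on
the CLOSED fibre, `HasDerivAt` the unbounded integrand on the OPEN fibre, `F(e₂) − F(e₃) = 0`).
[cite: KontsevichZagier2001, §1.2 rule (3)] [cite: BostanLairezSalvy2013, §1] -/
theorem of_hermiteBandRep_sub_mem_newtonLeibnizRel (h32 : e₃ < e₂) (h21 : e₂ < e₁)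
    (hf : ∀ x, cubic q₂ q₃ x = 4 * (x - e₃) * (x - e₂) * (x - e₁)) (P : ℚ[X]) :
    KZ.of (hermiteBandRep h32 h21 hf P) - KZ.of zeroBaseRep ∈ newtonLeibnizRel := by
  obtain ⟨he₃, he₂, -⟩ := cubic_roots_eq_zero hf
  obtain ⟨hpos, -⟩ := cubic_sign_of_roots h32 h21 hf
  refine ⟨0, hermiteBandRep h32 h21 hf P, zeroBaseRep, fun _ => e₃, fun _ => e₂,
    fun z => (Polynomial.aeval (z 0) P : ℝ) * Real.sqrt (cubic q₂ q₃ (z 0)),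
    ?_, ?_, ?_, fun _ _ => h32.le, rfl, ?_, ?_, ?_, rfl⟩
  · -- `F = P·√f` is semialgebraic on the band
    have hb := isSemialgebraic_closedBandQ h32 h21 hf
    have h1 := isSemialgebraicFunOn_aeval_apply_zero hb P
    have h2 : IsSemialgebraicFunOn ℚ (closedBandQ e₃ e₂)
        (fun z => Real.sqrt (MvPolynomial.aeval z (cubicPolyQ q₂ q₃))) :=
      IsSemialgebraicFunOn.sqrt_holds (isSemialgebraicFunOn_aeval hb (cubicPolyQ q₂ q₃))
    refine (IsSemialgebraicFunOn.mul_holds h1 h2).congr fun z _ => ?_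
    simp only [Pi.mul_apply, aeval_cubicPolyQ]
  · exact isSemialgebraicFunOn_const_root he₃
  · exact isSemialgebraicFunOn_const_root he₂
  · intro x _
    show ContinuousOn (fun t : ℝ => (Polynomial.aeval ((Fin.snoc x t : Fin 1 → ℝ) 0) P : ℝ) *
      Real.sqrt (cubic q₂ q₃ ((Fin.snoc x t : Fin 1 → ℝ) 0))) _
    simp only [snoc_apply_zero']
    exact ((Polynomial.continuous_aeval P).mul
      (Real.continuous_sqrt.comp continuous_cubic)).continuousOn
  · intro x _ t ht
    show HasDerivAt (fun s : ℝ => (Polynomial.aeval ((Fin.snoc x s : Fin 1 → ℝ) 0) P : ℝ) *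
      Real.sqrt (cubic q₂ q₃ ((Fin.snoc x s : Fin 1 → ℝ) 0)))
      ((hermiteBandRep h32 h21 hf P).integrand (Fin.snoc x t)) t
    simp only [snoc_apply_zero']
    have key := hasDerivAt_aeval_mul_sqrt P (hpos t ht)
    have hsame : (hermiteBandRep h32 h21 hf P).integrand (Fin.snoc x t) =
        hermiteIntegrand q₂ q₃ P (fun _ => t) := by
      show hermiteIntegrand q₂ q₃ P (Fin.snoc x t) = _
      simp only [hermiteIntegrand, snoc_apply_zero']
    rw [hsame]
    exact key
  · intro x _
    show (0 : ℝ) = (Polynomial.aeval ((Fin.snoc x ((fun _ => e₂) x) : Fin 1 → ℝ) 0) P : ℝ) *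
        Real.sqrt (cubic q₂ q₃ ((Fin.snoc x ((fun _ => e₂) x) : Fin 1 → ℝ) 0)) -
      (Polynomial.aeval ((Fin.snoc x ((fun _ => e₃) x) : Fin 1 → ℝ) 0) P : ℝ) *
        Real.sqrt (cubic q₂ q₃ ((Fin.snoc x ((fun _ => e₃) x) : Fin 1 → ℝ) 0))
    simp only [snoc_apply_zero', he₃, he₂, Real.sqrt_zero, mul_zero, sub_zero]

/-- `[hermiteBandRep] ∈ relations`. [folklore] -/
theorem of_hermiteBandRep_mem_relations (h32 : e₃ < e₂) (h21 : e₂ < e₁)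
    (hf : ∀ x, cubic q₂ q₃ x = 4 * (x - e₃) * (x - e₂) * (x - e₁)) (P : ℚ[X]) :
    KZ.of (hermiteBandRep h32 h21 hf P) ∈ relations := by
  have h1 := newtonLeibnizRel_subset_relations
    (of_hermiteBandRep_sub_mem_newtonLeibnizRel h32 h21 hf P)
  simpa using relations.add_mem h1 of_zeroBaseRep_mem_relations

/-- Closed band versus open `σ`: every `[σ, (P′f + Pf′/2)/√f]` is a relation. [folklore] -/
theorem of_mem_relations_of_hermite (h32 : e₃ < e₂) (h21 : e₂ < e₁)
    (hf : ∀ x, cubic q₂ q₃ x = 4 * (x - e₃) * (x - e₂) * (x - e₁)) (P : ℚ[X])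
    (r : IntegralRep 1) (hr : r.domain = oval q₂ q₃)
    (hri : EqOn r.integrand (hermiteIntegrand q₂ q₃ P) (oval q₂ q₃)) :
    KZ.of r ∈ KZ.relations := by
  have hadd : KZ.of (hermiteBandRep h32 h21 hf P) - KZ.of r - KZ.of (hermiteEndsRep hf P) ∈
      domainAddRel := by
    refine ⟨1, hermiteBandRep h32 h21 hf P, r, hermiteEndsRep hf P, ?_, ?_, fun p hp => ?_,
      fun _ _ => rfl, rfl⟩
    · show closedBandQ e₃ e₂ = r.domain ∪ endsQ e₃ e₂
      rw [hr]; exact closedBandQ_eq_union h32 h21 hf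
    · show volume (r.domain ∩ endsQ e₃ e₂) = 0
      rw [hr, oval_inter_endsQ h32 h21 hf]; exact measure_empty
    · rw [hr] at hp
      exact (hri hp).symm
  have h2 : KZ.of r = KZ.of (hermiteBandRep h32 h21 hf P) -
      (KZ.of (hermiteBandRep h32 h21 hf P) - KZ.of r - KZ.of (hermiteEndsRep hf P)) -
      KZ.of (hermiteEndsRep hf P) := by abel
  rw [h2]
  exact relations.sub_mem (relations.sub_mem (of_hermiteBandRep_mem_relations h32 h21 hf P)
    (domainAddRel_subset_relations hadd)) (of_mem_relations_of_volume_eq_zero _ (volume_endsQ e₃ e₂))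

end Hermite

/-- `stub_hermiteExactForm` = the route's support item `HermiteExactFormVanishes`
(stmt-KontsevichZagierPeriods-3412), VERBATIM, sorry-free. -/
theorem stub_hermiteExactForm :
    Summit.KontsevichZagierPeriods.KontsevichZagierPeriods.Theses.HermiteRigidity.HermiteExactFormVanishes := by
  intro q₂ q₃ hΔ P f σ r hr hri
  have hΔ' : 0 < disc q₂ q₃ := hΔ
  have hr' : r.domain = oval q₂ q₃ := hr
  have hri' : EqOn r.integrand (hermiteIntegrand q₂ q₃ P) (oval q₂ q₃) := hri
  obtain ⟨e₃, e₂, e₁, h3, h2a, h2b, h1, hf⟩ := exists_roots hΔ'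
  have h32 : e₃ < e₂ := by linarith
  have h21 : e₂ < e₁ := by linarith
  exact of_mem_relations_of_hermite h32 h21 hf P r hr' hri'

end Summit.KontsevichZagierPeriods.HermiteRigidity.EllipticMomentKernel.DrefuteG2.PartA

/-! # Part B — Disproof.lean §9 (cdisprove gen 2), verbatim, re-homed over the Negative vocabulary -/

namespace Summit.KontsevichZagierPeriods.HermiteRigidity.EllipticMomentKernel.DrefuteG2.VerticalDescentG2

open Literature.NumberTheory.Transcendental
open Literature.NumberTheory.Transcendental.KZ
open Summit.KontsevichZagierPeriods.HermiteRigidity.EllipticMomentKernelNegative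

section VerticalDescent

open Literature.ModelTheory.ExponentialFields (IsSemialgebraic isSemialgebraic_setOf_eval_pos
  isSemialgebraic_setOf_eval_eq_zero isSemialgebraic_univ)
open MvPolynomial (aeval X C)

variable {q₂ q₃ : ℚ}

/-- The upper bound of the vertical band: `b(x) = √f(x)` on `ℝ¹`. [folklore] -/
def sqrtCubic (q₂ q₃ : ℚ) (x : Fin 1 → ℝ) : ℝ := Real.sqrt (cubic q₂ q₃ (x 0))

/-- The CLOSED vertical band over the oval, in the literal shape of `KZ.newtonLeibnizRel` with base
`σ ⊆ ℝ¹` (open!) and the variable bounds `a = 0 ≤ b = √f`: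
`{z ∈ ℝ² | init z ∈ σ, 0 ≤ z_last ≤ √f((init z)₀)}`. [folklore] -/
def vBand (q₂ q₃ : ℚ) : Set (Fin 2 → ℝ) :=
  {z | (Fin.init z : Fin 1 → ℝ) ∈ oval q₂ q₃ ∧ (fun _ => (0 : ℝ)) (Fin.init z) ≤ z (Fin.last 1) ∧
    z (Fin.last 1) ≤ sqrtCubic q₂ q₃ (Fin.init z)}

/-- `Fin.init` on `ℝ²`: the first coordinate. [folklore] -/
theorem init_apply_zero (z : Fin 2 → ℝ) : (Fin.init z : Fin 1 → ℝ) 0 = z 0 := rfl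

/-- `Fin.snoc` on `ℝ¹ → ℝ²`: first coordinate. [folklore] -/
theorem snoc₂_apply_zero (x : Fin 1 → ℝ) (t : ℝ) : (Fin.snoc x t : Fin 2 → ℝ) 0 = x 0 := rfl

/-- `Fin.snoc` on `ℝ¹ → ℝ²`: last coordinate. [folklore] -/
theorem snoc₂_apply_one (x : Fin 1 → ℝ) (t : ℝ) : (Fin.snoc x t : Fin 2 → ℝ) 1 = t := rfl

/-- The vertical band, coordinate-wise: `{(x, y) | x ∈ σ, 0 ≤ y ≤ √f(x)}`. [folklore] -/
theorem mem_vBand_iff (z : Fin 2 → ℝ) :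
    z ∈ vBand q₂ q₃ ↔ (Fin.init z : Fin 1 → ℝ) ∈ oval q₂ q₃ ∧ 0 ≤ z 1 ∧
      z 1 ≤ Real.sqrt (cubic q₂ q₃ (z 0)) := Iff.rfl

/-- The general cubic as a `ℚ`-polynomial in the first of two variables. [folklore] -/
def cubicPoly₂ (q₂ q₃ : ℚ) : MvPolynomial (Fin 2) ℚ := 4 * X 0 ^ 3 - C q₂ * X 0 - C q₃

/-- Evaluation of `cubicPoly₂`. [folklore] -/
theorem aeval_cubicPoly₂ (p : Fin 2 → ℝ) : aeval p (cubicPoly₂ q₂ q₃) = cubic q₂ q₃ (p 0) := by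
  simp [cubicPoly₂, cubic, map_ofNat]

/-- **The vertical band is `ℚ`-semialgebraic** (quantifier-free: cylinder over `σ`, `0 ≤ y`,
`y² ≤ f(x)`). [folklore] -/
theorem isSemialgebraic_vBand (h : 0 < disc q₂ q₃) : IsSemialgebraic ℚ (vBand q₂ q₃) := by
  have h1 : IsSemialgebraic ℚ {z : Fin 2 → ℝ | (Fin.init z : Fin 1 → ℝ) ∈ oval q₂ q₃} :=
    (isSemialgebraic_oval h).setOf_init_mem
  have h2 : IsSemialgebraic ℚ {z : Fin 2 → ℝ | 0 ≤ z 1} := by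
    have ha := isSemialgebraic_setOf_eval_pos (k := ℚ) (R := ℝ) (X 1 : MvPolynomial (Fin 2) ℚ)
    have hb := isSemialgebraic_setOf_eval_eq_zero (k := ℚ) (R := ℝ) (X 1 : MvPolynomial (Fin 2) ℚ)
    convert ha.union hb using 1
    ext z
    simp only [mem_setOf_eq, mem_union, MvPolynomial.aeval_X]
    constructor
    · intro hz
      rcases hz.lt_or_eq with hz | hz
      · exact Or.inl hz
      · exact Or.inr hz.symm
    · rintro (hz | hz)
      · exact hz.le
      · exact hz.ge
  have h3 : IsSemialgebraic ℚ {z : Fin 2 → ℝ | z 1 ^ 2 ≤ cubic q₂ q₃ (z 0)} := by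
    have ha := isSemialgebraic_setOf_eval_pos (k := ℚ) (R := ℝ)
      (cubicPoly₂ q₂ q₃ - X 1 ^ 2 : MvPolynomial (Fin 2) ℚ)
    have hb := isSemialgebraic_setOf_eval_eq_zero (k := ℚ) (R := ℝ)
      (cubicPoly₂ q₂ q₃ - X 1 ^ 2 : MvPolynomial (Fin 2) ℚ)
    convert ha.union hb using 1
    ext z
    simp only [mem_setOf_eq, mem_union, map_sub, map_pow, MvPolynomial.aeval_X, aeval_cubicPoly₂]
    constructor
    · intro hz
      rcases hz.lt_or_eq with hz | hz
      · exact Or.inl (by linarith)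
      · exact Or.inr (by linarith)
    · rintro (hz | hz)
      · linarith
      · linarith
  convert h1.inter (h2.inter h3) using 1
  ext z
  simp only [mem_vBand_iff, mem_inter_iff, mem_setOf_eq]
  constructor
  · rintro ⟨hσ, h0, hle⟩
    refine ⟨hσ, h0, ?_⟩
    have hf : 0 ≤ cubic q₂ q₃ (z 0) := hσ.1.le
    calc z 1 ^ 2 ≤ Real.sqrt (cubic q₂ q₃ (z 0)) ^ 2 := by gcongr
      _ = cubic q₂ q₃ (z 0) := Real.sq_sqrt hf
  · rintro ⟨hσ, h0, hle⟩
    exact ⟨hσ, h0, (Real.le_sqrt h0 hσ.1.le).2 hle⟩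

/-- The vertical band lies in a compact box `[e₃, e₂] × [0, √M]`. [folklore] -/
theorem vBand_subset_Icc (h : 0 < disc q₂ q₃) :
    ∃ lo hi : Fin 2 → ℝ, vBand q₂ q₃ ⊆ Icc lo hi := by
  obtain ⟨e₃, e₂, e₁, h3, h2a, h2b, h1, hf⟩ := exists_roots h
  have h32 : e₃ < e₂ := by linarith
  have h21 : e₂ < e₁ := by linarith
  obtain ⟨M, hM⟩ : ∃ M, ∀ x ∈ Icc e₃ e₂, cubic q₂ q₃ x ≤ M := by
    obtain ⟨M, hM⟩ := isCompact_Icc.exists_bound_of_continuousOn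
      (continuous_cubic (q₂ := q₂) (q₃ := q₃)).continuousOn
    exact ⟨M, fun x hx => (le_abs_self _).trans (hM x hx)⟩
  refine ⟨![e₃, 0], ![e₂, Real.sqrt M], fun z hz => ?_⟩
  rw [mem_vBand_iff, oval_eq_of_roots h32 h21 hf] at hz
  obtain ⟨⟨hx1, hx2⟩, h0, hle⟩ := hz
  simp only [init_apply_zero] at hx1 hx2
  rw [mem_Icc, Pi.le_def, Pi.le_def]
  refine ⟨fun i => ?_, fun i => ?_⟩ <;> fin_cases i
  · exact hx1.le
  · exact h0
  · exact hx2.le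
  · exact hle.trans (Real.sqrt_le_sqrt (hM _ ⟨hx1.le, hx2.le⟩))

/-- The moment integrand `x^a y^b` is integrable on the (bounded) vertical band. [folklore] -/
theorem integrableOn_moment_vBand (h : 0 < disc q₂ q₃) (a b : ℕ) :
    IntegrableOn (fun p : Fin 2 → ℝ => p 0 ^ a * p 1 ^ b) (vBand q₂ q₃) := by
  obtain ⟨lo, hi, hsub⟩ := vBand_subset_Icc h
  have hc : Continuous fun p : Fin 2 → ℝ => p 0 ^ a * p 1 ^ b := by fun_prop
  exact (hc.continuousOn.integrableOn_compact isCompact_Icc).mono_set hsub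

/-- **The honest band representation `[vBand, x^a y^b]`** of the moment, for every admissible
parameter. [cite: KontsevichZagier2001, §1.1] -/
def vBandRep (h : 0 < disc q₂ q₃) (a b : ℕ) : IntegralRep 2 where
  domain := vBand q₂ q₃
  integrand := fun p => p 0 ^ a * p 1 ^ b
  isSemialgebraic_domain := isSemialgebraic_vBand h
  isSemialgebraicFunOn_integrand :=
    (isSemialgebraicFunOn_aeval (isSemialgebraic_vBand h)
      (X 0 ^ a * X 1 ^ b : MvPolynomial (Fin 2) ℚ)).congr fun p _ => by simp
  integrableOn := integrableOn_moment_vBand h a b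

/-- Powers of semialgebraic functions are semialgebraic. [cite: BochnakCosteRoy1998, Prop. 2.2.6] -/
theorem isSemialgebraicFunOn_pow {m : ℕ} {s : Set (Fin m → ℝ)} {g : (Fin m → ℝ) → ℝ}
    (hs : IsSemialgebraic ℚ s) (hg : IsSemialgebraicFunOn ℚ s g) (n : ℕ) :
    IsSemialgebraicFunOn ℚ s (fun x => g x ^ n) := by
  induction n with
  | zero =>
    exact (isSemialgebraicFunOn_aeval hs (1 : MvPolynomial (Fin m) ℚ)).congr fun _ _ => by simp
  | succ n ih =>
    exact (IsSemialgebraicFunOn.mul_holds ih hg).congr fun _ _ => by simp [pow_succ]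

/-- The descended integrand `x^a √f(x)^{b+1}/(b+1)` is `ℚ`-semialgebraic on `σ`. [folklore] -/
theorem isSemialgebraicFunOn_descended (h : 0 < disc q₂ q₃) (a b : ℕ) :
    IsSemialgebraicFunOn ℚ (oval q₂ q₃)
      (fun p => p 0 ^ a * Real.sqrt (cubic q₂ q₃ (p 0)) ^ (b + 1) / ((b : ℝ) + 1)) := by
  have hs := isSemialgebraic_oval h
  have h1 : IsSemialgebraicFunOn ℚ (oval q₂ q₃)
      (fun p => aeval p (X 0 ^ a : MvPolynomial (Fin 1) ℚ)) := isSemialgebraicFunOn_aeval hs _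
  have h2 : IsSemialgebraicFunOn ℚ (oval q₂ q₃) (fun p => Real.sqrt (cubic q₂ q₃ (p 0))) := by
    have := IsSemialgebraicFunOn.sqrt_holds (isSemialgebraicFunOn_aeval hs (cubicPolyQ q₂ q₃))
    exact this.congr fun p _ => by simp [aeval_cubicPolyQ]
  have h3 := isSemialgebraicFunOn_pow hs h2 (b + 1)
  have h4 : IsSemialgebraicFunOn ℚ (oval q₂ q₃)
      (fun p => aeval p (C (1 / ((b : ℚ) + 1)) : MvPolynomial (Fin 1) ℚ)) :=
    isSemialgebraicFunOn_aeval hs _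
  have h5 := IsSemialgebraicFunOn.mul_holds (IsSemialgebraicFunOn.mul_holds h1 h3) h4
  refine h5.congr fun p _ => ?_
  simp only [Pi.mul_apply, map_pow, MvPolynomial.aeval_X, MvPolynomial.aeval_C, eq_ratCast]
  push_cast
  ring

/-- The descended integrand is integrable on `σ` (continuous, `σ` bounded). [folklore] -/
theorem integrableOn_descended (h : 0 < disc q₂ q₃) (a b : ℕ) :
    IntegrableOn (fun p : Fin 1 → ℝ => p 0 ^ a * Real.sqrt (cubic q₂ q₃ (p 0)) ^ (b + 1) /
      ((b : ℝ) + 1)) (oval q₂ q₃) := by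
  obtain ⟨e₃, e₂, e₁, h3, h2a, h2b, h1, hf⟩ := exists_roots h
  have h32 : e₃ < e₂ := by linarith
  have h21 : e₂ < e₁ := by linarith
  have hsub : oval q₂ q₃ ⊆ Icc (fun _ => e₃) (fun _ => e₂) := by
    rw [oval_eq_of_roots h32 h21 hf]
    intro p hp
    rw [mem_Icc, Pi.le_def, Pi.le_def]
    exact ⟨fun i => by fin_cases i; exact hp.1.le, fun i => by fin_cases i; exact hp.2.le⟩
  have hc : Continuous fun p : Fin 1 → ℝ => p 0 ^ a * Real.sqrt (cubic q₂ q₃ (p 0)) ^ (b + 1) /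
      ((b : ℝ) + 1) := by
    have : Continuous fun p : Fin 1 → ℝ => cubic q₂ q₃ (p 0) :=
      continuous_cubic.comp (continuous_apply 0)
    fun_prop
  exact (hc.continuousOn.integrableOn_compact isCompact_Icc).mono_set hsub

/-- **The honest descended representation `[σ, x^a √f^{b+1}/(b+1)]`**. [cite: KontsevichZagier2001, §1.1] -/
def vBaseRep (h : 0 < disc q₂ q₃) (a b : ℕ) : IntegralRep 1 where
  domain := oval q₂ q₃
  integrand := fun p => p 0 ^ a * Real.sqrt (cubic q₂ q₃ (p 0)) ^ (b + 1) / ((b : ℝ) + 1)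
  isSemialgebraic_domain := isSemialgebraic_oval h
  isSemialgebraicFunOn_integrand := isSemialgebraicFunOn_descended h a b
  integrableOn := integrableOn_descended h a b

/-- **Vertical descent is ONE legal Newton–Leibniz move, for every admissible parameter and every
moment**: `[vBand, x^a y^b] − [σ, x^a √f^{b+1}/(b+1)] ∈ KZ.newtonLeibnizRel`, with base the OPEN
oval `σ`, bounds `a(x) = 0 ≤ b(x) = √f(x)` (both `ℚ`-semialgebraic on `σ`), polynomial primitive
`F(x, y) = x^a y^{b+1}/(b+1)` (semialgebraic on the band, continuous on each closed fibre, with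
`∂F/∂y = x^a y^b` on the open fibre) and `F(x, √f) − F(x, 0) = x^a √f^{b+1}/(b+1)`. This is the
rule-3 half of `stub_verticalDescent` (the other half is one (1a) move across the two null graphs
`y = 0`, `y = √f(x)` separating the closed band from the open `D`). [cite: KontsevichZagier2001, §1.2 rule (3)] -/
theorem of_vBandRep_sub_of_vBaseRep_mem_newtonLeibnizRel (h : 0 < disc q₂ q₃) (a b : ℕ) :
    KZ.of (vBandRep h a b) - KZ.of (vBaseRep h a b) ∈ newtonLeibnizRel := by
  have hs := isSemialgebraic_oval h
  refine ⟨1, vBandRep h a b, vBaseRep h a b, fun _ => 0, sqrtCubic q₂ q₃,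
    fun z => z 0 ^ a * z 1 ^ (b + 1) / ((b : ℝ) + 1), ?_, ?_, ?_, ?_, rfl, ?_, ?_, ?_, rfl⟩
  · -- `F` is semialgebraic on the band (a `ℚ`-polynomial)
    refine (isSemialgebraicFunOn_aeval (isSemialgebraic_vBand h)
      (C (1 / ((b : ℚ) + 1)) * X 0 ^ a * X 1 ^ (b + 1) : MvPolynomial (Fin 2) ℚ)).congr fun z _ => ?_
    simp only [map_mul, map_pow, MvPolynomial.aeval_X, MvPolynomial.aeval_C, eq_ratCast]
    push_cast
    ring
  · -- `a = 0` is semialgebraic on `σ`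
    exact (isSemialgebraicFunOn_aeval hs (0 : MvPolynomial (Fin 1) ℚ)).congr fun _ _ => by simp
  · -- `b = √f` is semialgebraic on `σ`
    have := IsSemialgebraicFunOn.sqrt_holds (isSemialgebraicFunOn_aeval hs (cubicPolyQ q₂ q₃))
    exact this.congr fun p _ => by simp [aeval_cubicPolyQ, sqrtCubic]
  · -- `a ≤ b`
    intro x _
    exact Real.sqrt_nonneg _
  · -- continuity of `t ↦ F (x, t)` on the closed fibre
    intro x _
    show ContinuousOn (fun t : ℝ => (Fin.snoc x t : Fin 2 → ℝ) 0 ^ a *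
      (Fin.snoc x t : Fin 2 → ℝ) 1 ^ (b + 1) / ((b : ℝ) + 1)) _
    simp only [snoc₂_apply_zero, snoc₂_apply_one]
    fun_prop
  · -- derivative on the open fibre
    intro x _ t _
    show HasDerivAt (fun s : ℝ => (Fin.snoc x s : Fin 2 → ℝ) 0 ^ a *
      (Fin.snoc x s : Fin 2 → ℝ) 1 ^ (b + 1) / ((b : ℝ) + 1))
      ((Fin.snoc x t : Fin 2 → ℝ) 0 ^ a * (Fin.snoc x t : Fin 2 → ℝ) 1 ^ b) t
    simp only [snoc₂_apply_zero, snoc₂_apply_one]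
    have hb : ((b : ℝ) + 1) ≠ 0 := by positivity
    have h1 : HasDerivAt (fun s : ℝ => s ^ (b + 1)) (((b + 1 : ℕ) : ℝ) * t ^ b) t := by
      simpa using hasDerivAt_pow (b + 1) t
    have h2 := (h1.const_mul (x 0 ^ a)).div_const ((b : ℝ) + 1)
    have key : x 0 ^ a * (((b + 1 : ℕ) : ℝ) * t ^ b) / ((b : ℝ) + 1) = x 0 ^ a * t ^ b := by
      rw [Nat.cast_succ, mul_div_assoc, mul_div_cancel_left₀ _ hb]
    rw [key] at h2
    exact h2
  · -- boundary values
    intro x _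
    show x 0 ^ a * Real.sqrt (cubic q₂ q₃ (x 0)) ^ (b + 1) / ((b : ℝ) + 1) =
      (Fin.snoc x (sqrtCubic q₂ q₃ x) : Fin 2 → ℝ) 0 ^ a *
        (Fin.snoc x (sqrtCubic q₂ q₃ x) : Fin 2 → ℝ) 1 ^ (b + 1) / ((b : ℝ) + 1) -
      (Fin.snoc x ((fun _ => (0 : ℝ)) x) : Fin 2 → ℝ) 0 ^ a *
        (Fin.snoc x ((fun _ => (0 : ℝ)) x) : Fin 2 → ℝ) 1 ^ (b + 1) / ((b : ℝ) + 1)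
    simp only [snoc₂_apply_zero, snoc₂_apply_one, sqrtCubic]
    rw [zero_pow (Nat.succ_ne_zero b)]
    ring

/-- Hence `[vBand, x^a y^b] ~ [σ, x^a √f^{b+1}/(b+1)]`. [cite: KontsevichZagier2001, §1.2 rule (3)] -/
theorem of_vBandRep_sub_of_vBaseRep_mem_relations (h : 0 < disc q₂ q₃) (a b : ℕ) :
    KZ.of (vBandRep h a b) - KZ.of (vBaseRep h a b) ∈ relations :=
  newtonLeibnizRel_subset_relations (of_vBandRep_sub_of_vBaseRep_mem_newtonLeibnizRel h a b)

/-! ### The (1a) passage: closed vertical band versus the open region `D` (two null graphs) -/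

/-- Graphs of measurable functions are Lebesgue-null in `ℝ²` (Tonelli: every vertical slice is a
point). [folklore] -/
theorem volume_graph_eq_zero {g : ℝ → ℝ} (hg : Measurable g) :
    volume {z : Fin 2 → ℝ | z 1 = g (z 0)} = 0 := by
  have e := MeasureTheory.volume_preserving_finTwoArrow ℝ
  have hmeas : MeasurableSet {p : ℝ × ℝ | p.2 = g p.1} :=
    measurableSet_eq_fun measurable_snd (hg.comp measurable_fst)
  have hset : {z : Fin 2 → ℝ | z 1 = g (z 0)} =
      MeasurableEquiv.finTwoArrow ⁻¹' {p : ℝ × ℝ | p.2 = g p.1} := by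
    ext z; simp
  rw [hset, e.measure_preimage hmeas.nullMeasurableSet, Measure.volume_eq_prod,
    Measure.prod_apply hmeas]
  have hslice : ∀ x : ℝ, volume (Prod.mk x ⁻¹' {p : ℝ × ℝ | p.2 = g p.1}) = 0 := by
    intro x
    have : Prod.mk x ⁻¹' {p : ℝ × ℝ | p.2 = g p.1} = {g x} := by
      ext y; simp
    rw [this, Real.volume_singleton]
  simp only [hslice, lintegral_zero]

/-- The two null graphs separating the closed band from `D`: `y = 0` and `y = √f(x)` over `σ`.
[folklore] -/
def vEnds (q₂ q₃ : ℚ) : Set (Fin 2 → ℝ) :=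
  {z | (Fin.init z : Fin 1 → ℝ) ∈ oval q₂ q₃ ∧ (z 1 = 0 ∨ z 1 = Real.sqrt (cubic q₂ q₃ (z 0)))}

/-- `vEnds` is Lebesgue-null. [folklore] -/
theorem volume_vEnds (q₂ q₃ : ℚ) : volume (vEnds q₂ q₃) = 0 := by
  have h0 := volume_graph_eq_zero (g := fun _ => (0 : ℝ)) measurable_const
  have h1 := volume_graph_eq_zero (g := fun x => Real.sqrt (cubic q₂ q₃ x))
    (Real.continuous_sqrt.comp continuous_cubic).measurable
  apply measure_mono_null (t := {z : Fin 2 → ℝ | z 1 = (fun _ => (0 : ℝ)) (z 0)} ∪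
    {z : Fin 2 → ℝ | z 1 = Real.sqrt (cubic q₂ q₃ (z 0))}) ?_ (measure_union_null h0 h1)
  rintro z ⟨-, hz | hz⟩
  · exact Or.inl hz
  · exact Or.inr hz

/-- `vEnds` is `ℚ`-semialgebraic (`y = 0`, or `y ≥ 0 ∧ y² = f(x)`, over the cylinder on `σ`).
[folklore] -/
theorem isSemialgebraic_vEnds (h : 0 < disc q₂ q₃) : IsSemialgebraic ℚ (vEnds q₂ q₃) := by
  have h1 : IsSemialgebraic ℚ {z : Fin 2 → ℝ | (Fin.init z : Fin 1 → ℝ) ∈ oval q₂ q₃} :=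
    (isSemialgebraic_oval h).setOf_init_mem
  have h2 := isSemialgebraic_setOf_eval_eq_zero (k := ℚ) (R := ℝ) (X 1 : MvPolynomial (Fin 2) ℚ)
  have h3 := isSemialgebraic_setOf_eval_eq_zero (k := ℚ) (R := ℝ)
    (cubicPoly₂ q₂ q₃ - X 1 ^ 2 : MvPolynomial (Fin 2) ℚ)
  have h4 : IsSemialgebraic ℚ {z : Fin 2 → ℝ | 0 ≤ z 1} := by
    have ha := isSemialgebraic_setOf_eval_pos (k := ℚ) (R := ℝ) (X 1 : MvPolynomial (Fin 2) ℚ)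
    convert ha.union h2 using 1
    ext z
    simp only [mem_setOf_eq, mem_union, MvPolynomial.aeval_X]
    constructor
    · intro hz
      rcases hz.lt_or_eq with hz | hz
      · exact Or.inl hz
      · exact Or.inr hz.symm
    · rintro (hz | hz)
      · exact hz.le
      · exact hz.ge
  convert h1.inter (h2.union (h4.inter h3)) using 1
  ext z
  simp only [vEnds, mem_setOf_eq, mem_inter_iff, mem_union, MvPolynomial.aeval_X, map_sub, map_pow,
    aeval_cubicPoly₂]
  constructor
  · rintro ⟨hσ, hz | hz⟩
    · exact ⟨hσ, Or.inl hz⟩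
    · refine ⟨hσ, Or.inr ⟨?_, ?_⟩⟩
      · rw [hz]; exact Real.sqrt_nonneg _
      · have hf : 0 ≤ cubic q₂ q₃ (z 0) := hσ.1.le
        rw [hz, Real.sq_sqrt hf]; ring
  · rintro ⟨hσ, hz | ⟨hz0, hz⟩⟩
    · exact ⟨hσ, Or.inl hz⟩
    · refine ⟨hσ, Or.inr ?_⟩
      have hf : 0 ≤ cubic q₂ q₃ (z 0) := hσ.1.le
      have : z 1 ^ 2 = cubic q₂ q₃ (z 0) := by linarith
      rw [← this, Real.sqrt_sq hz0]

/-- `vBand = D ∪ vEnds`. [folklore] -/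
theorem vBand_eq_union (q₂ q₃ : ℚ) : vBand q₂ q₃ = underGraph q₂ q₃ ∪ vEnds q₂ q₃ := by
  ext z
  simp only [mem_vBand_iff, underGraph, vEnds, mem_union, mem_setOf_eq]
  constructor
  · rintro ⟨hσ, h0, hle⟩
    have hσ' : 0 < cubic q₂ q₃ (z 0) ∧ ∃ t : ℝ, z 0 < t ∧ cubic q₂ q₃ t < 0 := hσ
    rcases h0.lt_or_eq with h0 | h0
    · rcases hle.lt_or_eq with hle | hle
      · left
        refine ⟨hσ', h0, ?_⟩
        calc z 1 ^ 2 < Real.sqrt (cubic q₂ q₃ (z 0)) ^ 2 := by gcongr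
          _ = cubic q₂ q₃ (z 0) := Real.sq_sqrt hσ'.1.le
      · exact Or.inr ⟨hσ, Or.inr hle⟩
    · exact Or.inr ⟨hσ, Or.inl h0.symm⟩
  · rintro (⟨hσ, h0, hlt⟩ | ⟨hσ, hz | hz⟩)
    · refine ⟨hσ, h0.le, ?_⟩
      exact (Real.lt_sqrt h0.le).2 hlt |>.le
    · have hσ' : 0 < cubic q₂ q₃ (z 0) ∧ ∃ t : ℝ, z 0 < t ∧ cubic q₂ q₃ t < 0 := hσ
      exact ⟨hσ, hz.ge, by rw [hz]; exact Real.sqrt_nonneg _⟩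
    · exact ⟨hσ, by rw [hz]; exact Real.sqrt_nonneg _, hz.le⟩

/-- `D` and `vEnds` are disjoint. [folklore] -/
theorem underGraph_inter_vEnds (q₂ q₃ : ℚ) : underGraph q₂ q₃ ∩ vEnds q₂ q₃ = ∅ := by
  ext z
  simp only [underGraph, vEnds, mem_inter_iff, mem_setOf_eq, mem_empty_iff_false, iff_false]
  rintro ⟨⟨hσ, h0, hlt⟩, -, hz | hz⟩
  · rw [hz] at h0; exact lt_irrefl _ h0
  · rw [hz, Real.sq_sqrt hσ.1.le] at hlt; exact lt_irrefl _ hlt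

/-- The moment restricted to the null graphs, as a representation. [folklore] -/
def vEndsRep (h : 0 < disc q₂ q₃) (a b : ℕ) : IntegralRep 2 where
  domain := vEnds q₂ q₃
  integrand := fun p => p 0 ^ a * p 1 ^ b
  isSemialgebraic_domain := isSemialgebraic_vEnds h
  isSemialgebraicFunOn_integrand :=
    (isSemialgebraicFunOn_aeval (isSemialgebraic_vEnds h)
      (X 0 ^ a * X 1 ^ b : MvPolynomial (Fin 2) ℚ)).congr fun p _ => by simp
  integrableOn := by
    rw [IntegrableOn, Measure.restrict_eq_zero.2 (volume_vEnds q₂ q₃)]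
    exact integrable_zero_measure

/-- A representation on a null domain is a relation (`[N] − [N] − [N] ∈ domainAddRel`). [folklore] -/
theorem of_vEndsRep_mem_relations (h : 0 < disc q₂ q₃) (a b : ℕ) :
    KZ.of (vEndsRep h a b) ∈ relations := by
  have hmem : KZ.of (vEndsRep h a b) - KZ.of (vEndsRep h a b) - KZ.of (vEndsRep h a b) ∈
      domainAddRel :=
    ⟨2, vEndsRep h a b, vEndsRep h a b, vEndsRep h a b, (union_self _).symm,
      by rw [inter_self]; exact volume_vEnds q₂ q₃, fun _ _ => rfl, fun _ _ => rfl, rfl⟩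
  have h' := domainAddRel_subset_relations hmem
  have : KZ.of (vEndsRep h a b) =
      -(KZ.of (vEndsRep h a b) - KZ.of (vEndsRep h a b) - KZ.of (vEndsRep h a b)) := by abel
  rw [this]
  exact relations.neg_mem h'

/-- **`stub_verticalDescent`, PROVED for every admissible parameter** (with the skeleton's
decorative hypothesis `hσ : IsSemialgebraic ℚ σ` dropped): for every representation `r` of the
moment `[D, x^a y^b]` there is a representation `s = [σ, x^a √f^{b+1}/(b+1)]` with
`[r] − [s] ∈ KZ.relations` — ONE (1a) move `[vBand] − [r] − [vEnds]` (null overlap `D ∩ vEnds = ∅`),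
the null representation `[vEnds] ~ 0`, and the rule-3 move
`of_vBandRep_sub_of_vBaseRep_mem_newtonLeibnizRel`. Over the vocabulary of this file
(`oval/underGraph/cubic/disc`, definitionally equal to the `EllipticMomentKernelNegative` copies).
[cite: KontsevichZagier2001, §1.2 rules (1) and (3)] -/
theorem verticalDescent (h : 0 < disc q₂ q₃) (a b : ℕ) (r : IntegralRep 2)
    (hr : r.domain = underGraph q₂ q₃)
    (hri : EqOn r.integrand (fun p => p 0 ^ a * p 1 ^ b) (underGraph q₂ q₃)) :
    ∃ s : IntegralRep 1, s.domain = oval q₂ q₃ ∧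
      EqOn s.integrand (fun p => p 0 ^ a * Real.sqrt (cubic q₂ q₃ (p 0)) ^ (b + 1) / ((b : ℝ) + 1))
        (oval q₂ q₃) ∧
      KZ.of r - KZ.of s ∈ relations := by
  refine ⟨vBaseRep h a b, rfl, fun _ _ => rfl, ?_⟩
  -- the (1a) move
  have h1a : KZ.of (vBandRep h a b) - KZ.of r - KZ.of (vEndsRep h a b) ∈ domainAddRel := by
    refine ⟨2, vBandRep h a b, r, vEndsRep h a b, ?_, ?_, ?_, fun _ _ => rfl, rfl⟩
    · show vBand q₂ q₃ = r.domain ∪ vEnds q₂ q₃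
      rw [hr, vBand_eq_union]
    · show volume (r.domain ∩ vEnds q₂ q₃) = 0
      rw [hr, underGraph_inter_vEnds, measure_empty]
    · intro z hz
      rw [hr] at hz
      exact (hri hz).symm
  have hA := domainAddRel_subset_relations h1a
  have hB := of_vEndsRep_mem_relations h a b
  have hC := of_vBandRep_sub_of_vBaseRep_mem_relations h a b
  have : KZ.of r - KZ.of (vBaseRep h a b) =
      (KZ.of (vBandRep h a b) - KZ.of (vBaseRep h a b)) -
        (KZ.of (vBandRep h a b) - KZ.of r - KZ.of (vEndsRep h a b)) - KZ.of (vEndsRep h a b) := by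
    abel
  rw [this]
  exact relations.sub_mem (relations.sub_mem hC hA) hB


end VerticalDescent

end Summit.KontsevichZagierPeriods.HermiteRigidity.EllipticMomentKernel.DrefuteG2.VerticalDescentG2


/-! # Part C — the six stubs of `Lines/merge-first-single-hermite.lean`, verbatim, and its glue -/

namespace Summit.KontsevichZagierPeriods.HermiteRigidity.EllipticMomentKernel.DrefuteG2

open Literature.NumberTheory.Transcendental
open Literature.NumberTheory.Transcendental.KZ
open Summit.KontsevichZagierPeriods.HermiteRigidity.EllipticMomentKernelNegative
open Summit.KontsevichZagierPeriods.KontsevichZagierPeriods.Theses.HermiteRigidity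
  (EllipticMomentKernel HermiteExactFormVanishes)

/-! ## §0 Hermite's decomposition `ℚ[X] = ℚ ⊕ ℚ·X + D(ℚ[X])` (pure algebra, PROVED) -/

/-- **Hermite decomposition.** For the operator `D(P) = P′·f + P·f′/2` of the cubic
`f = 4X³ − q₂X − q₃` (so that `d(P√f) = D(P) dx/√f`), every `Q ∈ ℚ[X]` is `α + βX + D(P)` with
`α, β ∈ ℚ`, `P ∈ ℚ[X]`: `D(1) = 6X² − q₂/2` and
`D(X^{d+1}) = (4d+10)X^{d+3} − (d+3/2)q₂X^{d+1} − (d+1)q₃X^d` have non-vanishing pivots, so a strong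
induction on the exponent peels the top monomial; no hypothesis on `q₂, q₃`.
[cite: BostanLairezSalvy2013, §1] [cite: Lawden1989, §3.3 (3.3.33)] -/
theorem hermiteDecomposition (q₂ q₃ : ℚ) (Q : ℚ[X]) :
    ∃ (α β : ℚ) (P : ℚ[X]), Q = Polynomial.C α + Polynomial.C β * Polynomial.X +
      (Polynomial.derivative P * (4 * Polynomial.X ^ 3 - Polynomial.C q₂ * Polynomial.X - Polynomial.C q₃) +
        P * (Polynomial.C (1 / 2 : ℚ) * (12 * Polynomial.X ^ 2 - Polynomial.C q₂))) := by
  -- the Hermite operator as a `ℚ`-linear map (local, no new definition)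
  let D : ℚ[X] →ₗ[ℚ] ℚ[X] :=
    { toFun := fun P => Polynomial.derivative P *
          (4 * Polynomial.X ^ 3 - Polynomial.C q₂ * Polynomial.X - Polynomial.C q₃) +
        P * (Polynomial.C (1 / 2 : ℚ) * (12 * Polynomial.X ^ 2 - Polynomial.C q₂))
      map_add' := fun P Q => by
        simp only [Polynomial.derivative_add]; ring
      map_smul' := fun c P => by
        simp only [Polynomial.derivative_smul, smul_mul_assoc, smul_add, RingHom.id_apply] }
  have hDapply : ∀ P, D P = Polynomial.derivative P *
        (4 * Polynomial.X ^ 3 - Polynomial.C q₂ * Polynomial.X - Polynomial.C q₃) +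
      P * (Polynomial.C (1 / 2 : ℚ) * (12 * Polynomial.X ^ 2 - Polynomial.C q₂)) := fun P => rfl
  set M : Submodule ℚ ℚ[X] :=
    Submodule.span ℚ {(1 : ℚ[X]), Polynomial.X} ⊔ LinearMap.range D with hM
  have h1 : (1 : ℚ[X]) ∈ M := Submodule.mem_sup_left (Submodule.subset_span (by simp))
  have hX : (Polynomial.X : ℚ[X]) ∈ M := Submodule.mem_sup_left (Submodule.subset_span (by simp))
  have hD : ∀ P, D P ∈ M := fun P => Submodule.mem_sup_right ⟨P, rfl⟩
  -- `X² = (1/6)·(D(1) + q₂/2)`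
  have hX2 : (Polynomial.X : ℚ[X]) ^ 2 = (1 / 6 : ℚ) • (D 1 + (q₂ / 2 : ℚ) • (1 : ℚ[X])) := by
    rw [hDapply]
    apply Polynomial.funext
    intro x
    simp
    ring
  -- `X^{d+3} = (4d+10)⁻¹·(D(X^{d+1}) + (d+3/2)q₂·X^{d+1} + (d+1)q₃·X^d)`
  have hX3 : ∀ d : ℕ, (Polynomial.X : ℚ[X]) ^ (d + 3) = (1 / (4 * (d : ℚ) + 10)) •
      (D (Polynomial.X ^ (d + 1)) + (((d : ℚ) + 3 / 2) * q₂) • Polynomial.X ^ (d + 1) +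
        (((d : ℚ) + 1) * q₃) • Polynomial.X ^ d) := by
    intro d
    have hd : (4 * (d : ℚ) + 10) ≠ 0 := by positivity
    rw [hDapply]
    apply Polynomial.funext
    intro x
    simp
    field_simp
    ring
  have hpow : ∀ m : ℕ, (Polynomial.X : ℚ[X]) ^ m ∈ M := by
    intro m
    induction m using Nat.strong_induction_on with
    | _ m ih =>
      match m with
      | 0 => simpa using h1
      | 1 => simpa using hX
      | 2 =>
        rw [hX2]
        exact M.smul_mem _ (M.add_mem (hD 1) (M.smul_mem _ h1))
      | d + 3 =>
        rw [hX3 d]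
        exact M.smul_mem _ (M.add_mem (M.add_mem (hD _) (M.smul_mem _ (ih (d + 1) (by omega))))
          (M.smul_mem _ (ih d (by omega))))
  have hall : Q ∈ M := by
    induction Q using Polynomial.induction_on' with
    | add p q hp hq => exact M.add_mem hp hq
    | monomial n a =>
      rw [← Polynomial.C_mul_X_pow_eq_monomial, ← Polynomial.smul_eq_C_mul]
      exact M.smul_mem a (hpow n)
  rw [hM, Submodule.mem_sup] at hall
  obtain ⟨y, hy, z, hz, hyz⟩ := hall
  rw [Submodule.mem_span_pair] at hy
  obtain ⟨α, β, rfl⟩ := hy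
  obtain ⟨P, rfl⟩ := hz
  refine ⟨α, β, P, ?_⟩
  rw [← hyz, hDapply, Polynomial.smul_eq_C_mul, Polynomial.smul_eq_C_mul, mul_one]


/-! ## §1 The six registered stubs — DISCHARGED (signatures verbatim) -/

/-- `stub_sigmaRep` (verbatim) := gen-1 drefute `Drefute.stub_sigmaRep` (`carrierRep`).
[cite: KontsevichZagier2001, §1.1] -/
theorem stub_sigmaRep (q₂ q₃ : ℚ) (hΔ : 0 < disc q₂ q₃) (A B : ℚ[X]) :
    ∃ s : IntegralRep 1, s.domain = oval q₂ q₃ ∧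
      s.integrand = fun p => (Polynomial.aeval (p 0) A : ℝ) +
        (Polynomial.aeval (p 0) B : ℝ) / Real.sqrt (cubic q₂ q₃ (p 0)) :=
  PartA.stub_sigmaRep q₂ q₃ hΔ A B

/-- `stub_columnMove` (verbatim; the lead-held hardest stub) := Disproof §9 `verticalDescent`
(ONE Newton–Leibniz move along `y` over the OPEN base `σ`, polynomial primitive
`x^a y^{b+1}/(b+1)`, then ONE (1a) move across the null graphs `y = 0`, `y = √f`) followed by the
congruence of representations with equal domain and integrands agreeing on it.
[cite: KontsevichZagier2001, §1.2 rule (3)] -/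
theorem stub_columnMove (q₂ q₃ : ℚ) (hΔ : 0 < disc q₂ q₃) (a b : ℕ) (r : IntegralRep 2)
    (hr : r.domain = underGraph q₂ q₃)
    (hri : EqOn r.integrand (fun p => p 0 ^ a * p 1 ^ b) (underGraph q₂ q₃))
    (s : IntegralRep 1) (hs : s.domain = oval q₂ q₃)
    (hsi : EqOn s.integrand
      (fun p => p 0 ^ a * Real.sqrt (cubic q₂ q₃ (p 0)) ^ (b + 1) / ((b : ℝ) + 1)) (oval q₂ q₃)) :
    KZ.of r - KZ.of s ∈ KZ.relations := by
  obtain ⟨s', hs', hs'i, hrs'⟩ :=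
    VerticalDescentG2.verticalDescent hΔ a b r hr hri
  have hd : s.domain = s'.domain := by rw [hs, hs']
  have hss' : KZ.of s' - KZ.of s ∈ KZ.relations := by
    refine of_sub_of_mem_relations_of_eqOn hd fun p hp => ?_
    rw [hs'] at hp
    have hp' : p ∈ oval q₂ q₃ := hp
    rw [hs'i hp, hsi hp']
  have : KZ.of r - KZ.of s = (KZ.of r - KZ.of s') + (KZ.of s' - KZ.of s) := by abel
  rw [this]
  exact relations.add_mem hrs' hss'

/-- `stub_hermiteExactForm` (verbatim) = support item `HermiteExactFormVanishes` (3412) :=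
gen-1 drefute `Drefute.stub_hermiteExactForm`. [cite: KontsevichZagier2001, §1.2 rule (3)] -/
theorem stub_hermiteExactForm : HermiteExactFormVanishes :=
  PartA.stub_hermiteExactForm

/-- `stub_polynomialPart` (verbatim) := gen-1 drefute `Drefute.stub_polynomialPart`.
[cite: KontsevichZagier2001, §1.2 rule (3)] -/
theorem stub_polynomialPart (q₂ q₃ : ℚ) (hΔ : 0 < disc q₂ q₃) (A : ℚ[X]) :
    IsAlgebraic ℚ (∫ p in oval q₂ q₃, (Polynomial.aeval (p 0) A : ℝ)) ∧
    ((∫ p in oval q₂ q₃, (Polynomial.aeval (p 0) A : ℝ)) = 0 →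
      ∀ s : IntegralRep 1, s.domain = oval q₂ q₃ →
        EqOn s.integrand (fun p => (Polynomial.aeval (p 0) A : ℝ)) (oval q₂ q₃) →
        KZ.of s ∈ KZ.relations) :=
  PartA.stub_polynomialPart q₂ q₃ hΔ A

/-- `stub_numeratorValue` (verbatim) := gen-1 drefute `Drefute.stub_numeratorValue`.
[cite: KontsevichZagier2001, §1.1] -/
theorem stub_numeratorValue (q₂ q₃ : ℚ) (hΔ : 0 < disc q₂ q₃) (A E : ℚ[X]) (α β : ℚ)
    (hE : (∫ p in oval q₂ q₃, (Polynomial.aeval (p 0) E : ℝ) / Real.sqrt (cubic q₂ q₃ (p 0))) = 0)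
    (s : IntegralRep 1) (hs : s.domain = oval q₂ q₃)
    (hsi : EqOn s.integrand (fun p => (Polynomial.aeval (p 0) A : ℝ) +
      (Polynomial.aeval (p 0) (Polynomial.C α + Polynomial.C β * Polynomial.X + E) : ℝ) /
        Real.sqrt (cubic q₂ q₃ (p 0))) (oval q₂ q₃)) :
    s.value = (∫ p in oval q₂ q₃, (Polynomial.aeval (p 0) A : ℝ)) +
      (α : ℝ) * J0 q₂ q₃ + (β : ℝ) * J1 q₂ q₃ :=
  PartA.stub_numeratorValue
    q₂ q₃ hΔ A E α β hE s hs hsi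

/-- `stub_mergeToCarrier` (verbatim) := gen-1 drefute `Drefute.stub_mergeToCarrier`.
[cite: KontsevichZagier2001, §1.2 rule (1)] -/
theorem stub_mergeToCarrier (q₂ q₃ : ℚ) (hΔ : 0 < disc q₂ q₃)
    (hrep : ∀ A B : ℚ[X], ∃ s : IntegralRep 1, s.domain = oval q₂ q₃ ∧
      s.integrand = fun p => (Polynomial.aeval (p 0) A : ℝ) +
        (Polynomial.aeval (p 0) B : ℝ) / Real.sqrt (cubic q₂ q₃ (p 0)))
    (hgen₂ : ∀ x ∈ gens₂ q₂ q₃, ∃ (A B : ℚ[X]) (s : IntegralRep 1), s.domain = oval q₂ q₃ ∧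
      EqOn s.integrand (fun p => (Polynomial.aeval (p 0) A : ℝ) +
        (Polynomial.aeval (p 0) B : ℝ) / Real.sqrt (cubic q₂ q₃ (p 0))) (oval q₂ q₃) ∧
      x - KZ.of s ∈ KZ.relations) :
    ∀ c ∈ AddSubgroup.closure (gens q₂ q₃), ∃ (A B : ℚ[X]) (s : IntegralRep 1),
      s.domain = oval q₂ q₃ ∧
      EqOn s.integrand (fun p => (Polynomial.aeval (p 0) A : ℝ) +
        (Polynomial.aeval (p 0) B : ℝ) / Real.sqrt (cubic q₂ q₃ (p 0))) (oval q₂ q₃) ∧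
      c - KZ.of s ∈ KZ.relations :=
  PartA.stub_mergeToCarrier
    q₂ q₃ hΔ hrep hgen₂

/-! ## §2 Glue (PROVED): parity bookkeeping of the column move, soundness, the end game -/

/-- `√x ^ (2k) = x ^ k` for `x ≥ 0`. [folklore] -/
theorem sqrt_pow_two_mul {x : ℝ} (hx : 0 ≤ x) (k : ℕ) : Real.sqrt x ^ (2 * k) = x ^ k := by
  rw [pow_mul, Real.sq_sqrt hx]

/-- `√x ^ (2k+1) = x ^ (k+1) / √x` for `x > 0`. [folklore] -/
theorem sqrt_pow_two_mul_add_one {x : ℝ} (hx : 0 < x) (k : ℕ) :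
    Real.sqrt x ^ (2 * k + 1) = x ^ (k + 1) / Real.sqrt x := by
  have hs : 0 < Real.sqrt x := Real.sqrt_pos.2 hx
  rw [pow_succ, sqrt_pow_two_mul hx.le, eq_div_iff hs.ne', mul_assoc, Real.mul_self_sqrt hx.le,
    pow_succ]

/-- Evaluation of the cubic `4X³ − q₂X − q₃ ∈ ℚ[X]` at a real point is `cubic q₂ q₃`. [folklore] -/
theorem aeval_cubic (q₂ q₃ : ℚ) (x : ℝ) :
    (Polynomial.aeval x (4 * Polynomial.X ^ 3 - Polynomial.C q₂ * Polynomial.X - Polynomial.C q₃ : ℚ[X]) : ℝ)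
      = cubic q₂ q₃ x := by
  simp [cubic, map_ofNat]

/-- **The column move in carrier form** (glue over `stub_sigmaRep` + `stub_columnMove`): every
2-dimensional generator `[D, x^a y^b]` is congruent to a carrier, with `(A, B) = (x^a f^{k+1}/(b+1), 0)`
if `b = 2k+1` and `(A, B) = (0, x^a f^{k+1}/(b+1))` if `b = 2k` (on `σ`, where `f > 0`,
`(√f)^{2k+2} = f^{k+1}` and `(√f)^{2k+1} = f^{k+1}/√f`). [cite: KontsevichZagier2001, §1.2] -/
theorem gens₂_carrier (q₂ q₃ : ℚ) (hΔ : 0 < disc q₂ q₃) :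
    ∀ x ∈ gens₂ q₂ q₃, ∃ (A B : ℚ[X]) (s : IntegralRep 1), s.domain = oval q₂ q₃ ∧
      EqOn s.integrand (fun p => (Polynomial.aeval (p 0) A : ℝ) +
        (Polynomial.aeval (p 0) B : ℝ) / Real.sqrt (cubic q₂ q₃ (p 0))) (oval q₂ q₃) ∧
      x - KZ.of s ∈ KZ.relations := by
  rintro x ⟨r, a, b, hr, hri, rfl⟩
  -- the reduced numerator `x^a f^{k+1}/(b+1)`
  set fQ : ℚ[X] := 4 * Polynomial.X ^ 3 - Polynomial.C q₂ * Polynomial.X - Polynomial.C q₃ with hfQ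
  rcases Nat.even_or_odd b with ⟨k, hk⟩ | ⟨k, hk⟩
  · -- `b = k + k` even: `(√f)^{b+1} = f^k √f = f^{k+1}/√f`, an elliptic carrier
    set B : ℚ[X] := Polynomial.C (1 / ((b : ℚ) + 1)) * Polynomial.X ^ a * fQ ^ (k + 1) with hB
    obtain ⟨s, hs, hsi⟩ := stub_sigmaRep q₂ q₃ hΔ 0 B
    refine ⟨0, B, s, hs, fun p _ => by rw [hsi], ?_⟩
    refine stub_columnMove q₂ q₃ hΔ a b r hr hri s hs fun p hp => ?_
    have hf : 0 < cubic q₂ q₃ (p 0) := hp.1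
    have hsq : 0 < Real.sqrt (cubic q₂ q₃ (p 0)) := Real.sqrt_pos.2 hf
    have hb1 : ((b : ℝ) + 1) ≠ 0 := by positivity
    rw [hsi]
    simp only [map_zero, zero_add, hB, map_mul, Polynomial.aeval_C, map_pow, Polynomial.aeval_X,
      eq_ratCast, hfQ, aeval_cubic]
    rw [show b + 1 = 2 * k + 1 by omega, sqrt_pow_two_mul_add_one hf k]
    push_cast
    field_simp
  · -- `b = 2k + 1` odd: `(√f)^{b+1} = f^{k+1}`, a polynomial carrier
    set A : ℚ[X] := Polynomial.C (1 / ((b : ℚ) + 1)) * Polynomial.X ^ a * fQ ^ (k + 1) with hA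
    obtain ⟨s, hs, hsi⟩ := stub_sigmaRep q₂ q₃ hΔ A 0
    refine ⟨A, 0, s, hs, fun p _ => by rw [hsi], ?_⟩
    refine stub_columnMove q₂ q₃ hΔ a b r hr hri s hs fun p hp => ?_
    have hf : 0 < cubic q₂ q₃ (p 0) := hp.1
    have hb1 : ((b : ℝ) + 1) ≠ 0 := by positivity
    rw [hsi]
    simp only [map_zero, zero_div, add_zero, hA, map_mul, Polynomial.aeval_C, map_pow,
      Polynomial.aeval_X, eq_ratCast, hfQ, aeval_cubic]
    rw [show b + 1 = 2 * (k + 1) by omega, sqrt_pow_two_mul hf.le (k + 1)]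
    push_cast
    field_simp

/-- Soundness, pointwise: a relation has value `0`. [cite: KontsevichZagier2001, §1.2] -/
theorem eval_eq_zero_of_mem_relations {c : FormalRep} (hc : c ∈ KZ.relations) : KZ.eval c = 0 :=
  (AddMonoidHom.mem_ker).1 (relations_le_ker_eval_holds hc)

/-- **The exact part has value zero** (glue over `stub_hermiteExactForm` + `stub_sigmaRep` +
soundness): `∫_σ D(P)/√f = 0`, because `[σ, D(P)/√f]` exists and is a relation.
[cite: KontsevichZagier2001, §1.2] -/
theorem integral_hermiteOp_div_sqrt_eq_zero (q₂ q₃ : ℚ) (hΔ : 0 < disc q₂ q₃) (P : ℚ[X]) :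
    (∫ p in oval q₂ q₃, (Polynomial.aeval (p 0)
        (Polynomial.derivative P * (4 * Polynomial.X ^ 3 - Polynomial.C q₂ * Polynomial.X - Polynomial.C q₃) +
          P * (Polynomial.C (1 / 2 : ℚ) * (12 * Polynomial.X ^ 2 - Polynomial.C q₂))) : ℝ) /
        Real.sqrt (cubic q₂ q₃ (p 0))) = 0 := by
  set E : ℚ[X] := Polynomial.derivative P *
      (4 * Polynomial.X ^ 3 - Polynomial.C q₂ * Polynomial.X - Polynomial.C q₃) +
    P * (Polynomial.C (1 / 2 : ℚ) * (12 * Polynomial.X ^ 2 - Polynomial.C q₂)) with hE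
  obtain ⟨t, ht, hti⟩ := stub_sigmaRep q₂ q₃ hΔ 0 E
  -- `t = [σ, D(P)/√f]` is the representation of the support item `HermiteExactFormVanishes`
  have hmem : KZ.of t ∈ KZ.relations := by
    refine stub_hermiteExactForm q₂ q₃ hΔ P t ht fun p _ => ?_
    rw [hti]
    simp only [map_zero, zero_add, hE, map_add, map_mul, Polynomial.aeval_C, eq_ratCast, map_sub,
      map_pow, Polynomial.aeval_X, map_ofNat, cubic]
    push_cast
    ring
  have hval : t.value = 0 := by rw [← eval_of]; exact eval_eq_zero_of_mem_relations hmem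
  have hmeas : MeasurableSet (oval q₂ q₃) := ht ▸ IntegralRep.measurableSet_domain_holds t
  calc (∫ p in oval q₂ q₃, (Polynomial.aeval (p 0) E : ℝ) / Real.sqrt (cubic q₂ q₃ (p 0)))
      = ∫ p in oval q₂ q₃, t.integrand p := by
        refine setIntegral_congr_fun hmeas fun p _ => ?_
        rw [hti]
        simp
    _ = t.value := by rw [IntegralRep.value, ht]
    _ = 0 := hval

/-- The inlined rigidity in the form the end game consumes: `A + αJ₀ + βJ₁ = 0` with `A` real
algebraic and `α, β ∈ ℚ` forces `A = 0`, `α = β = 0`. [cite: Masser1975, Thm II/III] -/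
theorem rigid_coordinates {q₂ q₃ : ℚ} (hR : Rigid q₂ q₃) {A : ℝ} {α β : ℚ} (hA : IsAlgebraic ℚ A)
    (h : A + (α : ℝ) * J0 q₂ q₃ + (β : ℝ) * J1 q₂ q₃ = 0) : A = 0 ∧ α = 0 ∧ β = 0 := by
  obtain ⟨h₁, h₂, h₃⟩ := hR A α β hA (isAlgebraic_algebraMap (R := ℚ) (A := ℝ) α)
    (isAlgebraic_algebraMap (R := ℚ) (A := ℝ) β) h
  exact ⟨h₁, by exact_mod_cast h₂, by exact_mod_cast h₃⟩

/-- **The crux `EllipticMomentKernel`, composed from the six stubs** (line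
`merge-first-single-hermite`): merge `c` to a carrier `[σ, A + B/√f]`; Hermite `B = α + βX + D(P)`;
value `∫_σ A + αJ₀ + βJ₁ = eval c = 0`; rigidity ⇒ `α = β = 0 = ∫_σ A`; so the carrier is
`[σ, A] + [σ, D(P)/√f]` (rule 1b), both relations. [cite: KontsevichZagier2001, §1.2]
[cite: Masser1975, Thm II/III] [cite: BostanLairezSalvy2013, §1] -/
theorem EllipticMomentKernel_of : EllipticMomentKernel := by
  rw [ellipticMomentKernel_iff]
  intro q₂ q₃ hΔ hR c hc h0
  -- MERGE: `c ≡ [σ, A + B/√f]`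
  obtain ⟨A, B, s, hs, hsi, hcs⟩ :=
    stub_mergeToCarrier q₂ q₃ hΔ (stub_sigmaRep q₂ q₃ hΔ) (gens₂_carrier q₂ q₃ hΔ) c hc
  -- HERMITE: `B = α + βX + D(P)`
  obtain ⟨α, β, P, hB⟩ := hermiteDecomposition q₂ q₃ B
  set E : ℚ[X] := Polynomial.derivative P *
      (4 * Polynomial.X ^ 3 - Polynomial.C q₂ * Polynomial.X - Polynomial.C q₃) +
    P * (Polynomial.C (1 / 2 : ℚ) * (12 * Polynomial.X ^ 2 - Polynomial.C q₂)) with hE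
  have hE0 := integral_hermiteOp_div_sqrt_eq_zero q₂ q₃ hΔ P
  rw [← hE] at hE0
  -- VALUE: `value s = ∫_σ A + αJ₀ + βJ₁ = eval c = 0`
  have hval := stub_numeratorValue q₂ q₃ hΔ A E α β hE0 s hs (by rw [← hB]; exact hsi)
  have hs0 : s.value = 0 := by
    have h1 : KZ.eval (c - KZ.of s) = 0 := eval_eq_zero_of_mem_relations hcs
    rw [map_sub, h0, eval_of, zero_sub, neg_eq_zero] at h1
    exact h1
  obtain ⟨hAalg, hA0⟩ := stub_polynomialPart q₂ q₃ hΔ A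
  -- RIGIDITY: the merged numerator is exact
  obtain ⟨hIA, rfl, rfl⟩ := rigid_coordinates hR hAalg (by rw [← hval, hs0])
  have hBE : B = E := by rw [hB]; simp
  -- SPLIT the carrier by rule 1b into `[σ, A]` and `[σ, D(P)/√f]`, both relations
  obtain ⟨sA, hsA, hsAi⟩ := stub_sigmaRep q₂ q₃ hΔ A 0
  obtain ⟨t, ht, hti⟩ := stub_sigmaRep q₂ q₃ hΔ 0 E
  have hsplit : KZ.of s - KZ.of sA - KZ.of t ∈ KZ.relations := by
    refine integrandAddRel_subset_relations ⟨1, s, sA, t, hsA.trans hs.symm, ht.trans hs.symm,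
      fun p hp => ?_, rfl⟩
    rw [hs] at hp
    rw [hsi hp, Pi.add_apply, hsAi, hti, hBE]
    simp
  have hsA0 : KZ.of sA ∈ KZ.relations :=
    hA0 hIA sA hsA fun p _ => by rw [hsAi]; simp
  have ht0 : KZ.of t ∈ KZ.relations := by
    refine stub_hermiteExactForm q₂ q₃ hΔ P t ht fun p _ => ?_
    rw [hti]
    simp only [map_zero, zero_add, hE, map_add, map_mul, Polynomial.aeval_C, eq_ratCast, map_sub,
      map_pow, Polynomial.aeval_X, map_ofNat, cubic]
    push_cast
    ring
  have hs_rel : KZ.of s ∈ KZ.relations := by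
    have : KZ.of s = (KZ.of s - KZ.of sA - KZ.of t) + KZ.of sA + KZ.of t := by abel
    rw [this]
    exact relations.add_mem (relations.add_mem hsplit hsA0) ht0
  have : c = (c - KZ.of s) + KZ.of s := by abel
  rw [this]
  exact relations.add_mem hcs hs_rel


/-! # Part D — interface checks for the hardest stub `stub_columnMove` (refuter's non-vacuity /
non-triviality record): its hypotheses have HONEST inhabitants for every admissible parameter and
every `(a, b)` (the 2-dimensional generator `[D, x^a y^b]` as a genuine `KZ.IntegralRep 2` — not
constructed anywhere in the tree before — and the descended `[σ, x^a √f^{b+1}/(b+1)]`), so the stub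
is not vacuous and `gens₂ ≠ ∅`; and its conclusion is not cheap: for `a` even the difference
`[r] − [s]` has `dimEval 2 = value r > 0`, hence lies outside the Newton–Leibniz-free sub-calculus
`noNL` (Disproof §3) — the rule-3 instance of Part B is forced. -/

section Interface

open Literature.ModelTheory.ExponentialFields (IsSemialgebraic)
open MvPolynomial (X)

variable {q₂ q₃ : ℚ}

/-- `D = vBand ∖ vEnds` (the closed band minus its two null graphs). [folklore] -/
theorem underGraph_eq_vBand_diff (q₂ q₃ : ℚ) :
    underGraph q₂ q₃ = VerticalDescentG2.vBand q₂ q₃ \ VerticalDescentG2.vEnds q₂ q₃ := by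
  have hd := VerticalDescentG2.underGraph_inter_vEnds q₂ q₃
  rw [VerticalDescentG2.vBand_eq_union]
  ext z
  simp only [mem_sdiff, mem_union]
  constructor
  · intro hz
    refine ⟨Or.inl hz, fun he => ?_⟩
    have hmem : z ∈ underGraph q₂ q₃ ∩ VerticalDescentG2.vEnds q₂ q₃ := ⟨hz, he⟩
    rw [hd] at hmem
    exact hmem
  · rintro ⟨hz | hz, hne⟩
    · exact hz
    · exact (hne hz).elim

/-- **`D` is `ℚ`-semialgebraic** for every admissible parameter. [folklore] -/
theorem isSemialgebraic_underGraph (h : 0 < disc q₂ q₃) : IsSemialgebraic ℚ (underGraph q₂ q₃) := by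
  rw [underGraph_eq_vBand_diff]
  exact (VerticalDescentG2.isSemialgebraic_vBand h).diff (VerticalDescentG2.isSemialgebraic_vEnds h)

/-- **The honest 2-dimensional generator `[D, x^a y^b]`** as a `KZ.IntegralRep 2`, for every
admissible parameter. [cite: KontsevichZagier2001, §1.1] -/
def underGraphRep (h : 0 < disc q₂ q₃) (a b : ℕ) : IntegralRep 2 where
  domain := underGraph q₂ q₃
  integrand := fun p => p 0 ^ a * p 1 ^ b
  isSemialgebraic_domain := isSemialgebraic_underGraph h
  isSemialgebraicFunOn_integrand :=
    (isSemialgebraicFunOn_aeval (isSemialgebraic_underGraph h)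
      (X 0 ^ a * X 1 ^ b : MvPolynomial (Fin 2) ℚ)).congr fun p _ => by simp
  integrableOn := (VerticalDescentG2.integrableOn_moment_vBand h a b).mono_set (by
    rw [VerticalDescentG2.vBand_eq_union]; exact subset_union_left)

/-- `[D, x^a y^b] ∈ gens₂`. [folklore] -/
theorem of_underGraphRep_mem_gens₂ (h : 0 < disc q₂ q₃) (a b : ℕ) :
    KZ.of (underGraphRep h a b) ∈ gens₂ q₂ q₃ :=
  ⟨underGraphRep h a b, a, b, rfl, fun _ _ => rfl, rfl⟩

/-- **The 2-dimensional half of the sector is non-empty** for every admissible parameter.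
[folklore] -/
theorem gens₂_nonempty (h : 0 < disc q₂ q₃) : (gens₂ q₂ q₃).Nonempty :=
  ⟨_, of_underGraphRep_mem_gens₂ h 0 0⟩

/-- **`stub_columnMove` is not vacuous**: all four hypotheses `hr, hri, hs, hsi` are satisfiable
simultaneously, for every admissible parameter and every `(a, b)`. [folklore] -/
theorem stub_columnMove_nonvacuous (h : 0 < disc q₂ q₃) (a b : ℕ) :
    ∃ (r : IntegralRep 2) (s : IntegralRep 1), r.domain = underGraph q₂ q₃ ∧
      EqOn r.integrand (fun p => p 0 ^ a * p 1 ^ b) (underGraph q₂ q₃) ∧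
      s.domain = oval q₂ q₃ ∧
      EqOn s.integrand
        (fun p => p 0 ^ a * Real.sqrt (cubic q₂ q₃ (p 0)) ^ (b + 1) / ((b : ℝ) + 1)) (oval q₂ q₃) :=
  ⟨underGraphRep h a b, VerticalDescentG2.vBaseRep h a b, rfl, fun _ _ => rfl, rfl, fun _ _ => rfl⟩

/-- **`stub_columnMove` is not cheap**: for `a` even (e.g. the area `a = b = 0`) the congruence it
asserts is NOT derivable in the Newton–Leibniz-free sub-calculus `noNL` (moves (1a), (1b), (2)),
for ANY representations `r, s` as in its hypotheses — `dimEval 2 ([r] − [s]) = value r > 0`.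
So the rule-3 instance of Part B is load-bearing. [cite: KontsevichZagier2001, §1.2] -/
theorem stub_columnMove_not_noNL (h : 0 < disc q₂ q₃) {a : ℕ} (ha : Even a) (b : ℕ)
    (r : IntegralRep 2) (hr : r.domain = underGraph q₂ q₃)
    (hri : EqOn r.integrand (fun p => p 0 ^ a * p 1 ^ b) (underGraph q₂ q₃))
    (s : IntegralRep 1) : KZ.of r - KZ.of s ∉ noNL := by
  refine not_mem_noNL_of_dimEval_ne_zero (d := 2) ?_
  rw [map_sub, dimEval_of, dimEval_of]
  simp only [if_true]
  norm_num
  exact (value_pos_of_gens₂ h ha hr hri).ne'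

/-- … while of course it IS a relation (Part C `stub_columnMove`), of value zero: the honest
instance `[D, x^a y^b] ~ [σ, x^a √f^{b+1}/(b+1)]`. [cite: KontsevichZagier2001, §1.2 rule (3)] -/
theorem underGraphRep_equivalent_vBaseRep (h : 0 < disc q₂ q₃) (a b : ℕ) :
    KZ.Equivalent (underGraphRep h a b) (VerticalDescentG2.vBaseRep h a b) :=
  stub_columnMove q₂ q₃ h a b _ rfl (fun _ _ => rfl) _ rfl (fun _ _ => rfl)

end Interface

/-! ## Pins: the certificate's conclusions, by FULL name of the route decls -/

/-- The crux decl itself, by full name. -/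
example : Summit.KontsevichZagierPeriods.KontsevichZagierPeriods.Theses.HermiteRigidity.EllipticMomentKernel :=
  EllipticMomentKernel_of

/-- The support item 3412, by full name. -/
example : Summit.KontsevichZagierPeriods.KontsevichZagierPeriods.Theses.HermiteRigidity.HermiteExactFormVanishes :=
  stub_hermiteExactForm

end Summit.KontsevichZagierPeriods.HermiteRigidity.EllipticMomentKernel.DrefuteG2
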